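import Summits.QuantumFields.YangMills.Theorems.BalabanUVNodesN06AtOpsYOfLettersAllPins
import Summits.QuantumFields.YangMills.Theorems.BalabanUVNodesN06AtRecord11ObligationsPins6
import Literature.MathematicalPhysics.QuantumFieldTheory.Balaban1983to89.B9Ineq343GpAtLetters
import Literature.MathematicalPhysics.QuantumFieldTheory.Balaban1983to89.B9RowSum261DefiniteFaces
import Literature.MathematicalPhysics.QuantumFieldTheory.Balaban1983to89.B9Ineq347GAAtLetters
import Literature.MathematicalPhysics.QuantumFieldTheory.Balaban1983to89.B9Thm314WholePair
import Literature.MathematicalPhysics.QuantumFieldTheory.Balaban1983to89.B9Thm314WholePinGeometry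

/-!
# BalabanUVNodes ∕ N06 ([B9], `Dag.B9_main`) — THE WHOLE STAGE-11 CERTIFICATE AT def-Y's INSTANCE ON THE ALL-BLOCKS PINS, III («N06 WHOLE-STATEMENT MODULE» of director №117 (B)):
# ROW 12 DISCHARGED (n06-h), ROW 11 BY n06-h's FIVE-LEAF FACE, ROWS 22–23 ON THE PAIR (n06-m), THE (3.43) ∕ (3.46)₃,₅ MEMBERS OF ROWS 18–19 PROVED (n06-k)

Track A of `YM-PLAN.md` (cell `pub-ymgap`, D-0062), node **N06** = [Balaban1985BackgroundPropagators] Thms 3.1–3.15; seat `pub-ymgap-dag-n06-d` gen 3 = N06-ASSIGNMENT v1 (P3).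
Sequel of `…N06AtOpsYOfLettersAllPins` (p474247) ∕ `…AllPinsB` (p477264): the ORIGINAL certificate `…N06AtRecord11CB10YZW.b9_main_of_up_view₁₁B10YZW_of_obligations` (p449575) at `ops :=
opsYOfLetters N θ M⋆ 𝔏 𝔈`, all 28 operator-layer binders supplied by lemma, E-letters on n06-k's all-blocks pins, with EVERY supplier landed to date consumed BY NAME: (i) ROW 12 `hGA` =
n06-h's `B9Ineq347GAAtLetters.hGA_opsYOfLetters` (no hypothesis); (ii) ROW 11 `hGp` = n06-h's `B9Ineq343GpAtLetters.hGp_opsYOfLetters_of_leaves5 hGpL3 hGpL4 hGpL5 hGpE4 hGpH2` (p477966 over p477286: the (3.47)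
leaf, the (3.46) members n = 0, 1, 2 and the (3.43) leaf of G′(1) proved there; displayed: (3.46)₃,₄,₅ ∕ (3.44) ∕ (3.45) of G′(1) on site arguments — all second order); (iii) ROWS 22–23 `⟨t314, t314loc⟩` = n06-m's
`B9Thm314WholePair.thm314_pair_of_pair_reading` on the PAIR of expansions, geometry `locDataY` with the six geometric laws discharged by `locDataY_laws` (displayed: `h₁ h₂ : Thm310AllNormsPrinted …`,
`X₁ Meets₁ X₂ Meets₂ diam r₀ hr`, `nearᵢ first_memᵢ chainᵢ`, the pair's summation reading `W hW hcnt hdom`); (iv) ROWS 18–19 `t37`, `t310` = `…ObligationsPins6.t37_of_allPin_lap` ∕ `t310_of_allPin_lap`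
on n06-k's `thm37∕thm310Printed_allPin_schur_holder_lap` (p477383, over p475516 ∕ p474790): the (3.43) HÖLDER MEMBER and the (3.46) LAPLACIAN LINES n = 3, 5 of the random-walk sums (3.90) G′(U) ∕
(3.107) G(U) are PROVED inside the leaves from Cor. 3.6's Hölder legs, the V-terms ∕ transposed factors read through the PROBE LETTERS of (3.40) (`𝔭 𝔭3 : HolderProbes …`), the Laplacian legs and
the transpose letters `hadjL hadjLA` (packages `h36H h36H3`, co-readings `hH1 hl3 hl5 hH13 hlA3 hlA5`, supports `SH SL SH3 SL3` with counts, constants `Bl BV BL Bl3 θH3 BL3` with `hBβ hBL5 hBβ3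
hB53`, member facts at rate δ₀ `hfacts₀ hfactsA₀`) — so `hrest` ∕ `hrestA` now display ONLY (3.44), (3.45) and the two-sided L² line (3.46)₄ (cell GAPS G-B9-02∕07); (v) ROWS 15–16 `⟨t39, hksum⟩` =
n06-j's `B9RowSum261DefiniteFaces.t39_hksum_of_pin_rowConst261` (p476417): the pin's constant is the DEFINITE `rowConst261 geo9Y (α′r)` and the (2.61) binder `h261_39`
(+ `R39 H39 ML39 hB₁39 hδ₁39`) is GONE, discharged by n06-i's `rowSum261_geo9Y`.  HONEST FRAMING.  def-Y's layer
of LETTERS (U = 1 clauses), not Bałaban's constructed operators (def-Y v2 `lettersYOfRecord` re-instantiates `𝔏` by unification); every row supplied MODULO displayed hypothesis schemas of printed ∕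
located shape (rows 1–8, 12, row 11's (3.47)∕(3.46)₀₋₂∕(3.43) leaves, rows 18–19's (3.42)∕(3.43)∕(3.46)₀₋₃,₅∕(3.47) members discharged at the instance); nothing of [B9] proved for Bałaban's operators;
N06 NOT discharged; count-neutral.  One finite 𝕋⁴ programme at fixed `ε` — NOT ℝ⁴ ∕ OS ∕ mass gap ∕ Clay.  0 `def`, 0 `sorry`.
-/





noncomputable section

namespace Summit.QuantumFields.YangMills.BalabanUVNodes.N06AtOpsYOfLettersAllPinsC

open Literature.MathematicalPhysics.QuantumFieldTheory.Balaban1983to89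
open Literature.MathematicalPhysics.QuantumFieldTheory.Balaban1983to89.T4Continuum (T4Family)
open Literature.MathematicalPhysics.QuantumFieldTheory.Balaban1983to89.DagBinding (WorldP leavesP)
open Literature.MathematicalPhysics.QuantumFieldTheory.Balaban1983to89.Node00
open Literature.MathematicalPhysics.QuantumFieldTheory.Balaban1983to89.B9PinMembersKLevelV1 (MemberY geo9Y bg9Y)
open Literature.MathematicalPhysics.QuantumFieldTheory.Balaban1983to89.B9PinGeometryKLevelV1 (dOmegaY OmKY inΛY unitDistY c35Y c35Y_pos kLab dOmegaY_nonneg)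
open Literature.MathematicalPhysics.QuantumFieldTheory.Balaban1983to89.B9Thm314GpFlatTorusGeometry (tdistK OmegaC)
open Literature.MathematicalPhysics.QuantumFieldTheory.Balaban1983to89.B9Thm314WholePair (pairExpansion pairTermK locData₂ thm314_pair_of_pair_reading)
open Literature.MathematicalPhysics.QuantumFieldTheory.Balaban1983to89.B9Thm314WholePinGeometry (locDataY locDataY_laws)
open Literature.MathematicalPhysics.QuantumFieldTheory.Balaban1983to89.B9Thm314WholeSummation (WalkSetsSpec WalkWeightsSummable DominatedBySums)
open Literature.MathematicalPhysics.QuantumFieldTheory.Balaban1983to89.B9SectCWalkTermsAllNorms (Thm310AllNormsPrinted)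
open Literature.MathematicalPhysics.QuantumFieldTheory.Balaban1983to89.B9Ineq347GAAtLetters (hGA_opsYOfLetters)
open Literature.MathematicalPhysics.QuantumFieldTheory.Balaban1983to89.B7Prop2SpecialUnitary (specialUnitaryUnits)
open Literature.MathematicalPhysics.QuantumFieldTheory.Balaban1983to89.B9Thm37Whole (Ops Sizes StaticOK Local342 Identities const37)
open Literature.MathematicalPhysics.QuantumFieldTheory.Balaban1983to89.B9Cor38Whole (WalkReading Locality W38OfOps)
open Literature.MathematicalPhysics.QuantumFieldTheory.Balaban1983to89.B9Thm37GlueCor36 (CoRealizes)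
open Literature.MathematicalPhysics.QuantumFieldTheory.Balaban1983to89.B6RandomWalk (Ineq261)
open Literature.MathematicalPhysics.QuantumFieldTheory.Balaban1983to89.B9Thm34Ext (toB6)
open Literature.MathematicalPhysics.QuantumFieldTheory.Balaban1983to89.B9SectBStepWhole
  (StepE StepL2n StepGlob StepH1 StepE4 StepH2 StepKer StepAnalytic)
open Literature.MathematicalPhysics.QuantumFieldTheory.Balaban1983to89.B9Ineq349Whole (Dict349)
open Literature.MathematicalPhysics.QuantumFieldTheory.Balaban1983to89.B9Eq3132Whole (CTInputs InvNormalised WeightsTransfer)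
open Literature.MathematicalPhysics.QuantumFieldTheory.Balaban1983to89.B9ResidualEntriesAtOne (AtOneL2nOn AtOneE4On AtOneH2On)
open Literature.MathematicalPhysics.QuantumFieldTheory.Balaban1983to89.B9Thm39Whole
  (Ops39 WalkReading39 EK39OfOps StaticOK39 Local348 Identities395 Small285 Factors389 Locality39 KerReads)
open Literature.MathematicalPhysics.QuantumFieldTheory.Balaban1983to89.B9Thm311Whole (Ops311 PosDefOfOps Inputs311)
open Literature.MathematicalPhysics.QuantumFieldTheory.Balaban1983to89.B9Thm310Whole
  (Ops310 WalkReading310 Sizes310 StaticOK310 Locality310 Local342G Identities310 W310OfOps Conv3107)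
open Literature.MathematicalPhysics.QuantumFieldTheory.Balaban1983to89.B9Thm315Whole (Ops315 Reads315 Static315 GivenBy3185OfOps HasRWExpCOfOps)
open Literature.MathematicalPhysics.QuantumFieldTheory.Balaban1983to89.B9GeoLemma21KLevelV1
  (distOK_geo9Y levelGap_geo9Y_one rowSum261_geo9Y geo9Y_dist_triangle geo9Y_dist_comm geo9Y_len_pos)
open Literature.MathematicalPhysics.QuantumFieldTheory.Balaban1983to89.B9GeoNormsKLevelModelSignsV1 (modelSignsOn_geo9K)
open Summit.QuantumFields.YangMills.BalabanUVNodes.N06AtRecord11ObligationsPins (t311_of_pin t315_of_pins)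
open Literature.MathematicalPhysics.QuantumFieldTheory.Balaban1983to89.B9Cor35ComparisonsGAAtLetters
  (hGA_e_opsYOfLetters hGA_h1_opsYOfLetters hGA_e4_opsYOfLetters hGA_h2_opsYOfLetters hGA_l2_opsYOfLetters hnullGA_opsYOfLetters)
open Literature.MathematicalPhysics.QuantumFieldTheory.Balaban1983to89.B9Cor35ComparisonsGpCAtLetters (hGp_e_opsYOfLetters hGp_h1_opsYOfLetters hC_opsYOfLetters)
open Summit.QuantumFields.YangMills.BalabanUVNodes.N06AtRecord11ObligationsPins2 (s3132_of_inputs)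
open Literature.MathematicalPhysics.QuantumFieldTheory.Balaban1983to89.B9RowSum261DefiniteFaces (rowConst261 t39_hksum_of_pin_rowConst261)
open Literature.MathematicalPhysics.QuantumFieldTheory.Balaban1983to89.B9Thm312Whole (GeoOK Thm33G0 FormSmall HasRWExpOfOps HasRWExpHOfOps PosDefKOfOps)
open Literature.MathematicalPhysics.QuantumFieldTheory.Balaban1983to89.B11SectG (RowSum)
open Literature.MathematicalPhysics.QuantumFieldTheory.Balaban1983to89.B9FromB6 (L2Block)
open Literature.MathematicalPhysics.QuantumFieldTheory.Balaban1983to89.B9Thm37GlueCor36 (Clause342)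
open Literature.MathematicalPhysics.QuantumFieldTheory.Balaban1983to89.B9Thm312WholeLeaf (thm312Printed_of_step)
open Literature.MathematicalPhysics.QuantumFieldTheory.Balaban1983to89.B9Thm313Whole (Letters313 thm313Printed_of_step)
open Literature.MathematicalPhysics.QuantumFieldTheory.Balaban1983to89.B9GeoNormsKLevelV1 (geo9K_dist_nonneg)
open Literature.MathematicalPhysics.QuantumFieldTheory.Balaban1983to89.B9Thm37Glue (IsTransposePair)
open Literature.MathematicalPhysics.QuantumFieldTheory.Balaban1983to89.B9RWSums343to347Whole (GlobReads Facts347 ConvAll3107 E37AllOfOps)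
open Literature.MathematicalPhysics.QuantumFieldTheory.Balaban1983to89.B9RWSums346Schur (L2Reads)
open Literature.MathematicalPhysics.QuantumFieldTheory.Balaban1983to89.B9Cor35ComparisonsEH (hE4_of_hGA_e4 hH2_of_hGA_h2)
open Literature.MathematicalPhysics.QuantumFieldTheory.Balaban1983to89.B9Ineq349Whole (stmt349Printed_of_thm31_thm32)
open Summit.QuantumFields.YangMills.BalabanUVNodes.N06AtRecord11ObligationsSectBn (hB_obligation_of_memberSteps)
open Summit.QuantumFields.YangMills.BalabanUVNodes.N06AtRecord11ObligationsHg (hg_obligation_vacuous)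
open Summit.QuantumFields.YangMills.BalabanUVNodes.N06AtRecord11ObligationsPins4 (c38_of_allPin hsum_of_allPins)
open Summit.QuantumFields.YangMills.BalabanUVNodes.N06AtRecord11ObligationsPins6 (t37_of_allPin_lap t310_of_allPin_lap)
open Literature.MathematicalPhysics.QuantumFieldTheory.Balaban1983to89.B9RWSums343Holder (HolderProbes H1Reads HolderLegs310 FactorsHolder310 holderConst)
open Literature.MathematicalPhysics.QuantumFieldTheory.Balaban1983to89.B9RWSums343HolderGp (HolderLegs37 HolderV37)
open Literature.MathematicalPhysics.QuantumFieldTheory.Balaban1983to89.B9RWSums346Lap (LapLegs310 LapLegs37 lapConst)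
open Literature.MathematicalPhysics.QuantumFieldTheory.Balaban1983to89.B9Ineq343GpAtLetters (hGp_opsYOfLetters_of_leaves5)
open Summit.QuantumFields.YangMills.BalabanUVNodes.N06AtRecord11CB10YZW (b9_main_of_up_view₁₁B10YZW_of_obligations)
open scoped Matrix.Norms.L2Operator

variable {N : ℕ}

section Pointed

variable [NeZero N] {F : T4Family}

/-- **THE WHOLE STAGE-11 CERTIFICATE AT def-Y's INSTANCE ON THE ALL-BLOCKS PINS, III** (module docstring): `Dag.B9_main` at every run of a world bound over the four-pin Stage-11
view of `(θ, M⋆, opsYOfLetters N θ M⋆ 𝔏 𝔈, ζ, λ_W)`, every `𝔏 𝔈`; `hGA` ∕ `hGp` by n06-h's theorems, `t314 ∧ t314loc` by n06-m's pair theorem, `t37` ∕ `t310` with the (3.43) members and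
the (3.46)₃,₅ lines proved (n06-k via `…Pins6`), the rest as in `…_opsYOfLetters_allPins`.  NOT a discharge of N06. [cite: Balaban1985BackgroundPropagators, Thms 3.1–3.15 pp.397–432, Cor. 3.6 p.408, (3.40)
p.397, (3.43)–(3.47) p.398, Thm 3.14 p.427, Cor. 3.5 p.407; Balaban1984PropagatorsII, Prop. 2.6 (2.136) p.247, Lemma 2.1 pp.233–234] -/
theorem b9_main_of_up_view₁₁B10YZW_opsYOfLetters_allPins_r12pairH (θ : Stage11Params F N) (hθ : θ.Admissible) (Mstar : ℕ)
    (𝔏 : LettersY N θ.toStage3Params Mstar) (𝔈 : ExpsY N θ.toStage3Params Mstar) (ζ : ResidZ F N) (lamW : ResidW F N) (w : WorldP)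
    (hup : ∀ P, w.up P = upOfRecord₅C F N (θ.view₁₁B10YZW F N Mstar (opsYOfLetters N θ.toStage3Params Mstar 𝔏 𝔈) ζ lamW) P)
    (hA : StepAnalytic (θ.d₆ + 1) c35Y geo9Y (bg9Y (Matrix (Fin N) (Fin N) ℂ) (specialUnitaryUnits (Fin N))) (fun x => ((opsYOfLetters N θ.toStage3Params Mstar 𝔏 𝔈) x).Gp) (fun x => ((opsYOfLetters N θ.toStage3Params Mstar 𝔏 𝔈) x).GA)
      (fun x => ((opsYOfLetters N θ.toStage3Params Mstar 𝔏 𝔈) x).Cinv) (fun x => ((opsYOfLetters N θ.toStage3Params Mstar 𝔏 𝔈) x).IsAnalyticExt))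
    (hEp : StepE (θ.d₆ + 1) c35Y geo9Y (bg9Y (Matrix (Fin N) (Fin N) ℂ) (specialUnitaryUnits (Fin N))) (fun x => ((opsYOfLetters N θ.toStage3Params Mstar 𝔏 𝔈) x).Gp) (fun x => ((opsYOfLetters N θ.toStage3Params Mstar 𝔏 𝔈) x).GA)
      (fun x => ((opsYOfLetters N θ.toStage3Params Mstar 𝔏 𝔈) x).Cinv) (fun x => ((opsYOfLetters N θ.toStage3Params Mstar 𝔏 𝔈) x).Gp))
    (hLp : ∀ n : Fin 6, StepL2n (θ.d₆ + 1) c35Y geo9Y (bg9Y (Matrix (Fin N) (Fin N) ℂ) (specialUnitaryUnits (Fin N))) (fun x => ((opsYOfLetters N θ.toStage3Params Mstar 𝔏 𝔈) x).Gp) (fun x => ((opsYOfLetters N θ.toStage3Params Mstar 𝔏 𝔈) x).GA)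
      (fun x => ((opsYOfLetters N θ.toStage3Params Mstar 𝔏 𝔈) x).Cinv) (fun x => ((opsYOfLetters N θ.toStage3Params Mstar 𝔏 𝔈) x).Gp) n)
    (hGlp : StepGlob (θ.d₆ + 1) c35Y geo9Y (bg9Y (Matrix (Fin N) (Fin N) ℂ) (specialUnitaryUnits (Fin N))) (fun x => ((opsYOfLetters N θ.toStage3Params Mstar 𝔏 𝔈) x).Gp) (fun x => ((opsYOfLetters N θ.toStage3Params Mstar 𝔏 𝔈) x).GA)
      (fun x => ((opsYOfLetters N θ.toStage3Params Mstar 𝔏 𝔈) x).Cinv) (fun x => ((opsYOfLetters N θ.toStage3Params Mstar 𝔏 𝔈) x).Gp))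
    (hH1p : StepH1 (θ.d₆ + 1) c35Y geo9Y (bg9Y (Matrix (Fin N) (Fin N) ℂ) (specialUnitaryUnits (Fin N))) (fun x => ((opsYOfLetters N θ.toStage3Params Mstar 𝔏 𝔈) x).Gp) (fun x => ((opsYOfLetters N θ.toStage3Params Mstar 𝔏 𝔈) x).GA)
      (fun x => ((opsYOfLetters N θ.toStage3Params Mstar 𝔏 𝔈) x).Cinv) (fun x => ((opsYOfLetters N θ.toStage3Params Mstar 𝔏 𝔈) x).Gp))
    (hE4p : StepE4 (θ.d₆ + 1) c35Y geo9Y (bg9Y (Matrix (Fin N) (Fin N) ℂ) (specialUnitaryUnits (Fin N))) (fun x => ((opsYOfLetters N θ.toStage3Params Mstar 𝔏 𝔈) x).Gp) (fun x => ((opsYOfLetters N θ.toStage3Params Mstar 𝔏 𝔈) x).GA)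
      (fun x => ((opsYOfLetters N θ.toStage3Params Mstar 𝔏 𝔈) x).Cinv) (fun x => ((opsYOfLetters N θ.toStage3Params Mstar 𝔏 𝔈) x).Gp))
    (hH2p : StepH2 (θ.d₆ + 1) c35Y geo9Y (bg9Y (Matrix (Fin N) (Fin N) ℂ) (specialUnitaryUnits (Fin N))) (fun x => ((opsYOfLetters N θ.toStage3Params Mstar 𝔏 𝔈) x).Gp) (fun x => ((opsYOfLetters N θ.toStage3Params Mstar 𝔏 𝔈) x).GA)
      (fun x => ((opsYOfLetters N θ.toStage3Params Mstar 𝔏 𝔈) x).Cinv) (fun x => ((opsYOfLetters N θ.toStage3Params Mstar 𝔏 𝔈) x).Gp))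
    (hK : StepKer (θ.d₆ + 1) c35Y geo9Y (bg9Y (Matrix (Fin N) (Fin N) ℂ) (specialUnitaryUnits (Fin N))) (fun x => ((opsYOfLetters N θ.toStage3Params Mstar 𝔏 𝔈) x).Gp) (fun x => ((opsYOfLetters N θ.toStage3Params Mstar 𝔏 𝔈) x).GA)
      (fun x => ((opsYOfLetters N θ.toStage3Params Mstar 𝔏 𝔈) x).Cinv) (fun x => ((opsYOfLetters N θ.toStage3Params Mstar 𝔏 𝔈) x).Cinv))
    (hEa : StepE (θ.d₆ + 1) c35Y geo9Y (bg9Y (Matrix (Fin N) (Fin N) ℂ) (specialUnitaryUnits (Fin N))) (fun x => ((opsYOfLetters N θ.toStage3Params Mstar 𝔏 𝔈) x).Gp) (fun x => ((opsYOfLetters N θ.toStage3Params Mstar 𝔏 𝔈) x).GA)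
      (fun x => ((opsYOfLetters N θ.toStage3Params Mstar 𝔏 𝔈) x).Cinv) (fun x => ((opsYOfLetters N θ.toStage3Params Mstar 𝔏 𝔈) x).GA))
    (hLa : ∀ n : Fin 6, StepL2n (θ.d₆ + 1) c35Y geo9Y (bg9Y (Matrix (Fin N) (Fin N) ℂ) (specialUnitaryUnits (Fin N))) (fun x => ((opsYOfLetters N θ.toStage3Params Mstar 𝔏 𝔈) x).Gp) (fun x => ((opsYOfLetters N θ.toStage3Params Mstar 𝔏 𝔈) x).GA)
      (fun x => ((opsYOfLetters N θ.toStage3Params Mstar 𝔏 𝔈) x).Cinv) (fun x => ((opsYOfLetters N θ.toStage3Params Mstar 𝔏 𝔈) x).GA) n)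
    (hGla : StepGlob (θ.d₆ + 1) c35Y geo9Y (bg9Y (Matrix (Fin N) (Fin N) ℂ) (specialUnitaryUnits (Fin N))) (fun x => ((opsYOfLetters N θ.toStage3Params Mstar 𝔏 𝔈) x).Gp) (fun x => ((opsYOfLetters N θ.toStage3Params Mstar 𝔏 𝔈) x).GA)
      (fun x => ((opsYOfLetters N θ.toStage3Params Mstar 𝔏 𝔈) x).Cinv) (fun x => ((opsYOfLetters N θ.toStage3Params Mstar 𝔏 𝔈) x).GA))
    (hH1a : StepH1 (θ.d₆ + 1) c35Y geo9Y (bg9Y (Matrix (Fin N) (Fin N) ℂ) (specialUnitaryUnits (Fin N))) (fun x => ((opsYOfLetters N θ.toStage3Params Mstar 𝔏 𝔈) x).Gp) (fun x => ((opsYOfLetters N θ.toStage3Params Mstar 𝔏 𝔈) x).GA)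
      (fun x => ((opsYOfLetters N θ.toStage3Params Mstar 𝔏 𝔈) x).Cinv) (fun x => ((opsYOfLetters N θ.toStage3Params Mstar 𝔏 𝔈) x).GA))
    (hE4a : StepE4 (θ.d₆ + 1) c35Y geo9Y (bg9Y (Matrix (Fin N) (Fin N) ℂ) (specialUnitaryUnits (Fin N))) (fun x => ((opsYOfLetters N θ.toStage3Params Mstar 𝔏 𝔈) x).Gp) (fun x => ((opsYOfLetters N θ.toStage3Params Mstar 𝔏 𝔈) x).GA)
      (fun x => ((opsYOfLetters N θ.toStage3Params Mstar 𝔏 𝔈) x).Cinv) (fun x => ((opsYOfLetters N θ.toStage3Params Mstar 𝔏 𝔈) x).GA))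
    (hH2a : StepH2 (θ.d₆ + 1) c35Y geo9Y (bg9Y (Matrix (Fin N) (Fin N) ℂ) (specialUnitaryUnits (Fin N))) (fun x => ((opsYOfLetters N θ.toStage3Params Mstar 𝔏 𝔈) x).Gp) (fun x => ((opsYOfLetters N θ.toStage3Params Mstar 𝔏 𝔈) x).GA)
      (fun x => ((opsYOfLetters N θ.toStage3Params Mstar 𝔏 𝔈) x).Cinv) (fun x => ((opsYOfLetters N θ.toStage3Params Mstar 𝔏 𝔈) x).GA))
    [∀ x : MemberY θ.d₆ θ.ℓ₆ θ.hd' θ.hL' θ.b₀ θ.b₁ Mstar, Fintype (geo9Y x).Site] [∀ x : MemberY θ.d₆ θ.ℓ₆ θ.hd' θ.hL' θ.b₀ θ.b₁ Mstar, DecidableEq (geo9Y x).Site]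
    {X Y ι PX PY : MemberY θ.d₆ θ.ℓ₆ θ.hd' θ.hL' θ.b₀ θ.b₁ Mstar → Type} [∀ x, Fintype (X x)] [∀ x, DecidableEq (X x)] [∀ x, Fintype (Y x)] [∀ x, DecidableEq (Y x)]
    [∀ x, Fintype (ι x)] [∀ x, Fintype (PX x)] [∀ x, DecidableEq (PX x)] [∀ x, Fintype (PY x)] [∀ x, DecidableEq (PY x)]
    (hGpL3 : AtOneL2nOn geo9Y (bg9Y (Matrix (Fin N) (Fin N) ℂ) (specialUnitaryUnits (Fin N))) (fun x => ((opsYOfLetters N θ.toStage3Params Mstar 𝔏 𝔈) x).Gp) (fun _ lam => ¬ (lam.isRight = true)) 3)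
    (hGpL4 : AtOneL2nOn geo9Y (bg9Y (Matrix (Fin N) (Fin N) ℂ) (specialUnitaryUnits (Fin N))) (fun x => ((opsYOfLetters N θ.toStage3Params Mstar 𝔏 𝔈) x).Gp) (fun _ lam => ¬ (lam.isRight = true)) 4)
    (hGpL5 : AtOneL2nOn geo9Y (bg9Y (Matrix (Fin N) (Fin N) ℂ) (specialUnitaryUnits (Fin N))) (fun x => ((opsYOfLetters N θ.toStage3Params Mstar 𝔏 𝔈) x).Gp) (fun _ lam => ¬ (lam.isRight = true)) 5)
    (hGpE4 : AtOneE4On geo9Y (bg9Y (Matrix (Fin N) (Fin N) ℂ) (specialUnitaryUnits (Fin N))) (fun x => ((opsYOfLetters N θ.toStage3Params Mstar 𝔏 𝔈) x).Gp) (fun _ lam => ¬ (lam.isRight = true)))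
    (hGpH2 : AtOneH2On geo9Y (bg9Y (Matrix (Fin N) (Fin N) ℂ) (specialUnitaryUnits (Fin N))) (fun x => ((opsYOfLetters N θ.toStage3Params Mstar 𝔏 𝔈) x).Gp) (fun _ lam => ¬ (lam.isRight = true)))
    {ι39 κ39 : MemberY θ.d₆ θ.ℓ₆ θ.hd' θ.hL' θ.b₀ θ.b₁ Mstar → Type} [∀ x, Fintype (ι39 x)]
    (𝔬39 : ∀ x : MemberY θ.d₆ θ.ℓ₆ θ.hd' θ.hL' θ.b₀ θ.b₁ Mstar, Ops39 (geo9Y x) (bg9Y (Matrix (Fin N) (Fin N) ℂ) (specialUnitaryUnits (Fin N)) x) (ι39 x) (κ39 x))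
    (rd39 : ∀ x : MemberY θ.d₆ θ.ℓ₆ θ.hd' θ.hL' θ.b₀ θ.b₁ Mstar, WalkReading39 (bg9Y (Matrix (Fin N) (Fin N) ℂ) (specialUnitaryUnits (Fin N)) x) (ι39 x) (κ39 x))
    (α39 α' r39 δ39 θ39 B39 N39 a39 M39 : ℝ)
    (h39α : 0 < α39) (h39α1 : α39 < 1) (hα'0 : 0 < α') (hα'1 : α' < 1) (hr39 : 0 < r39) (hrδ39 : r39 ≤ δ39) (hθ39 : 0 ≤ θ39)
    (hB39 : 0 < B39) (hN39 : 0 ≤ N39) (ha39 : 0 < a39) (hM39 : 0 < M39) (hst39 : ∀ x, StaticOK39 (𝔬39 x) N39) (hloc39 : ∀ x, Locality39 (𝔬39 x) (rd39 x))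
    (h39 : ∀ x : MemberY θ.d₆ θ.ℓ₆ θ.hd' θ.hL' θ.b₀ θ.b₁ Mstar, M39 ≤ (geo9Y x).M → ∀ α₀ : ℝ, 0 < α₀ → c35Y * (geo9Y x).M * α₀ ≤ a39 →
      ∀ U : (bg9Y (Matrix (Fin N) (Fin N) ℂ) (specialUnitaryUnits (Fin N)) x).Cfg, (bg9Y (Matrix (Fin N) (Fin N) ℂ) (specialUnitaryUnits (Fin N)) x).Reg335 c35Y α₀ U →
        Local348 (𝔬39 x) (θ.d₆ + 1) B39 δ39 U ∧ Identities395 (𝔬39 x) U ∧ Small285 (𝔬39 x) (θ.d₆ + 1) θ39 r39 U ∧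
          Factors389 (𝔬39 x) (θ.d₆ + 1) θ39 δ39 U)
    (hEK39 : ∀ x : MemberY θ.d₆ θ.ℓ₆ θ.hd' θ.hL' θ.b₀ θ.b₁ Mstar, ((opsYOfLetters N θ.toStage3Params Mstar 𝔏 𝔈) x).EK39 = EK39OfOps (𝔬39 x) (rd39 x) (θ.d₆ + 1)
      (2 * (N39 * B39) * rowConst261 (geo9Y (d := θ.d₆) (ℓ := θ.ℓ₆) (hd := θ.hd') (hL := θ.hL') (b₀ := θ.b₀) (b₁ := θ.b₁) (Mstar := Mstar)) (α' * r39)) ((1 - α') * r39))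
    (hrdC : ∀ x : MemberY θ.d₆ θ.ℓ₆ θ.hd' θ.hL' θ.b₀ θ.b₁ Mstar, KerReads (𝔬39 x) ((opsYOfLetters N θ.toStage3Params Mstar 𝔏 𝔈) x).Cinv (θ.d₆ + 1))
    {S32 S32₁ : ∀ x : MemberY θ.d₆ θ.ℓ₆ θ.hd' θ.hL' θ.b₀ θ.b₁ Mstar, (bg9Y (Matrix (Fin N) (Fin N) ℂ) (specialUnitaryUnits (Fin N)) x).Cfg → Matrix (geo9Y x).Site (geo9Y x).Site ℝ}
    {w32 w32₁ : ∀ x : MemberY θ.d₆ θ.ℓ₆ θ.hd' θ.hL' θ.b₀ θ.b₁ Mstar, (geo9Y x).Site → ℝ}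
    (hCT : CTInputs c35Y geo9Y (bg9Y (Matrix (Fin N) (Fin N) ℂ) (specialUnitaryUnits (Fin N))) S32) (hCT₁ : CTInputs c35Y geo9Y (bg9Y (Matrix (Fin N) (Fin N) ℂ) (specialUnitaryUnits (Fin N))) S32₁)
    (hN32 : ∀ x : MemberY θ.d₆ θ.ℓ₆ θ.hd' θ.hL' θ.b₀ θ.b₁ Mstar, InvNormalised ((opsYOfLetters N θ.toStage3Params Mstar 𝔏 𝔈) x).QGQinv (S32 x) (w32 x)) (hN32₁ : ∀ x : MemberY θ.d₆ θ.ℓ₆ θ.hd' θ.hL' θ.b₀ θ.b₁ Mstar, InvNormalised ((opsYOfLetters N θ.toStage3Params Mstar 𝔏 𝔈) x).QG1Qinv (S32₁ x) (w32₁ x))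
    {A32 : ℝ} (hA32 : 0 < A32)
    (hwt : ∀ ε : ℝ, 0 < ε → ∃ Mw : ℝ, ∀ x : MemberY θ.d₆ θ.ℓ₆ θ.hd' θ.hL' θ.b₀ θ.b₁ Mstar, Mw ≤ (geo9Y x).M →
      WeightsTransfer (geo9Y x) (θ.d₆ + 1) (w32 x) ε A32 ∧ WeightsTransfer (geo9Y x) (θ.d₆ + 1) (w32₁ x) ε A32)
    (𝔬 : ∀ x, Ops (geo9Y x) (bg9Y (Matrix (Fin N) (Fin N) ℂ) (specialUnitaryUnits (Fin N)) x) (X x) (Y x) (ι x))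
    (rd : ∀ x, WalkReading (geo9Y x) (bg9Y (Matrix (Fin N) (Fin N) ℂ) (specialUnitaryUnits (Fin N)) x) (X x) (ι x))
    (𝔭 : ∀ x : MemberY θ.d₆ θ.ℓ₆ θ.hd' θ.hL' θ.b₀ θ.b₁ Mstar, HolderProbes (geo9Y x) (bg9Y (Matrix (Fin N) (Fin N) ℂ) (specialUnitaryUnits (Fin N)) x) (X x) (Y x) (PX x) (PY x)) (SH SL : ∀ x : MemberY θ.d₆ θ.ℓ₆ θ.hd' θ.hL' θ.b₀ θ.b₁ Mstar, ι x → Finset (geo9Y x).Site) (Bl BV : ℝ → ℝ) (NH NL BL MF : ℝ) (dL : ℕ)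
    (R : MemberY θ.d₆ θ.ℓ₆ θ.hd' θ.hL' θ.b₀ θ.b₁ Mstar → ℝ) (H : MemberY θ.d₆ θ.ℓ₆ θ.hd' θ.hL' θ.b₀ θ.b₁ Mstar → Prop)
    (κ : MemberY θ.d₆ θ.ℓ₆ θ.hd' θ.hL' θ.b₀ θ.b₁ Mstar → Sizes) (d : ℕ) (α ρ Nc N' Cℓ K θ₀ B₀ δ₀ a₁ M₁ ML : ℝ)
    (hα : 0 ≤ α) (hα2 : α ≤ 1 / 2) (hN : 0 ≤ Nc) (hN' : 0 ≤ N') (hCℓ : 1 ≤ Cℓ) (hK0 : 0 ≤ K) (hθ₀ : 0 ≤ θ₀) (hB₀ : 0 < B₀) (hδ₀ : 0 < δ₀) (ha₁ : 0 < a₁) (hM₁ : 0 < M₁) (hNH : 0 ≤ NH) (hNL : 0 ≤ NL) (hBL : 0 ≤ BL)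
    (hst : ∀ x, StaticOK (𝔬 x) ρ Nc N' Cℓ (κ x)) (hκ : ∀ x, (κ x).Bounded K θ₀ Cℓ (geo9Y x).M) (hrd : ∀ x, (rd x).OK (𝔬 x).blk) (hloc : ∀ x, Locality (𝔬 x) (rd x))
    (h261 : ∀ x, ML ≤ (geo9Y x).M → Ineq261 d (toB6 (geo9Y x) (R x) (H x)) δ₀ α)
    (h36 : ∀ x, M₁ ≤ (geo9Y x).M → ∀ α₀ : ℝ, 0 < α₀ → c35Y * (geo9Y x).M * α₀ ≤ a₁ →
      ∀ U : (bg9Y (Matrix (Fin N) (Fin N) ℂ) (specialUnitaryUnits (Fin N)) x).Cfg,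
        (bg9Y (Matrix (Fin N) (Fin N) ℂ) (specialUnitaryUnits (Fin N)) x).Reg335 c35Y α₀ U →
          Local342 (𝔬 x) (R x) (H x) B₀ δ₀ U ∧ Identities (𝔬 x) (R x) (H x) U)
    (h36H : ∀ x, M₁ ≤ (geo9Y x).M → ∀ α₀ : ℝ, 0 < α₀ → c35Y * (geo9Y x).M * α₀ ≤ a₁ → ∀ U : (bg9Y (Matrix (Fin N) (Fin N) ℂ) (specialUnitaryUnits (Fin N)) x).Cfg, (bg9Y (Matrix (Fin N) (Fin N) ℂ) (specialUnitaryUnits (Fin N)) x).Reg335 c35Y α₀ U →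
      HolderLegs37 (𝔬 x) (𝔭 x) (R x) (H x) (SH x) Bl δ₀ U ∧ HolderV37 (𝔬 x) (𝔭 x) (R x) (H x) BV δ₀ U ∧ LapLegs37 (𝔬 x) (R x) (H x) (SL x) BL δ₀ U)
    (hcntH : ∀ (x : MemberY θ.d₆ θ.ℓ₆ θ.hd' θ.hL' θ.b₀ θ.b₁ Mstar) (a : (geo9Y x).Site), (∑ q, if a ∈ SH x q then (1 : ℝ) else 0) ≤ NH) (hcntL : ∀ (x : MemberY θ.d₆ θ.ℓ₆ θ.hd' θ.hL' θ.b₀ θ.b₁ Mstar) (a : (geo9Y x).Site), (∑ q, if a ∈ SL x q then (1 : ℝ) else 0) ≤ NL)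
    (hBl : ∀ β, 0 ≤ β → β < 1 → 0 ≤ Bl β) (hBV : ∀ β, 0 ≤ β → β < 1 → 0 ≤ BV β)
    (evY : ∀ x : MemberY θ.d₆ θ.ℓ₆ θ.hd' θ.hL' θ.b₀ θ.b₁ Mstar, (geo9Y x).Loc → Y x → ℝ)
    (hco0 : ∀ x U, CoRealizes ((opsYOfLetters N θ.toStage3Params Mstar 𝔏 𝔈) x).Gp 0 U (𝔬 x).blk (𝔬 x).blk (rd x).ev ((𝔬 x).Gp U)) (hco1 : ∀ x U, CoRealizes ((opsYOfLetters N θ.toStage3Params Mstar 𝔏 𝔈) x).Gp 1 U (𝔬 x).blkY (𝔬 x).blk (rd x).ev ((𝔬 x).D U ∘ₗ (𝔬 x).Gp U))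
    (hco2 : ∀ x U, CoRealizes ((opsYOfLetters N θ.toStage3Params Mstar 𝔏 𝔈) x).Gp 2 U (𝔬 x).blk (𝔬 x).blkY (evY x) ((𝔬 x).Gp U ∘ₗ (𝔬 x).Dstar U)) (hco3 : ∀ x U, CoRealizes ((opsYOfLetters N θ.toStage3Params Mstar 𝔏 𝔈) x).Gp 3 U (𝔬 x).blk (𝔬 x).blk (rd x).ev ((𝔬 x).Lap U ∘ₗ (𝔬 x).Gp U))
    {B₁ δ₁ : ℝ} (hB₁ : 0 < B₁) (hδ₁ : 0 < δ₁) {Bβ Bε : ℝ → ℝ} {Bεβ : ℝ → ℝ → ℝ}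
    (hgl0 : ∀ x U, GlobReads ((opsYOfLetters N θ.toStage3Params Mstar 𝔏 𝔈) x).Gp 0 U (𝔬 x).blk (𝔬 x).blk (rd x).ev ((𝔬 x).Gp U)) (hgl1 : ∀ x U, GlobReads ((opsYOfLetters N θ.toStage3Params Mstar 𝔏 𝔈) x).Gp 1 U (𝔬 x).blkY (𝔬 x).blk (rd x).ev ((𝔬 x).D U ∘ₗ (𝔬 x).Gp U))
    (hgl2 : ∀ x U, GlobReads ((opsYOfLetters N θ.toStage3Params Mstar 𝔏 𝔈) x).Gp 2 U (𝔬 x).blk (𝔬 x).blkY (evY x) ((𝔬 x).Gp U ∘ₗ (𝔬 x).Dstar U)) (hgl3 : ∀ x U, GlobReads ((opsYOfLetters N θ.toStage3Params Mstar 𝔏 𝔈) x).Gp 3 U (𝔬 x).blk (𝔬 x).blk (rd x).ev ((𝔬 x).Lap U ∘ₗ (𝔬 x).Gp U))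
    (hl0 : ∀ x U, L2Reads (R := R x) (H := H x) ((opsYOfLetters N θ.toStage3Params Mstar 𝔏 𝔈) x).Gp 0 U (𝔬 x).blk (𝔬 x).blk (rd x).ev ((𝔬 x).Gp U)) (hl1 : ∀ x U, L2Reads (R := R x) (H := H x) ((opsYOfLetters N θ.toStage3Params Mstar 𝔏 𝔈) x).Gp 1 U (𝔬 x).blkY (𝔬 x).blk (rd x).ev ((𝔬 x).D U ∘ₗ (𝔬 x).Gp U))
    (hl2 : ∀ x U, L2Reads (R := R x) (H := H x) ((opsYOfLetters N θ.toStage3Params Mstar 𝔏 𝔈) x).Gp 2 U (𝔬 x).blk (𝔬 x).blkY (evY x) ((𝔬 x).Gp U ∘ₗ (𝔬 x).Dstar U)) (hl3 : ∀ x U, L2Reads (R := R x) (H := H x) ((opsYOfLetters N θ.toStage3Params Mstar 𝔏 𝔈) x).Gp 3 U (𝔬 x).blk (𝔬 x).blk (rd x).ev ((𝔬 x).Lap U ∘ₗ (𝔬 x).Gp U))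
    (hl5 : ∀ x U, L2Reads (R := R x) (H := H x) ((opsYOfLetters N θ.toStage3Params Mstar 𝔏 𝔈) x).Gp 5 U (𝔬 x).blk (𝔬 x).blk (rd x).ev ((𝔬 x).Gp U ∘ₗ (𝔬 x).Lap U))
    (hH1 : ∀ x U, H1Reads ((opsYOfLetters N θ.toStage3Params Mstar 𝔏 𝔈) x).Gp U (𝔭 x) (𝔬 x).blk (𝔬 x).blkY ((rd x).ev) (evY x) ((𝔬 x).D U ∘ₗ (𝔬 x).Gp U) ((𝔬 x).Gp U ∘ₗ (𝔬 x).Dstar U))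
    (hsym : ∀ x U, IsTransposePair ((𝔬 x).Gp U) ((𝔬 x).Gp U)) (htr : ∀ x U, IsTransposePair ((𝔬 x).D U ∘ₗ (𝔬 x).Gp U) ((𝔬 x).Gp U ∘ₗ (𝔬 x).Dstar U)) (hadjL : ∀ x U, IsTransposePair ((𝔬 x).Lap U ∘ₗ (𝔬 x).Gp U) ((𝔬 x).Gp U ∘ₗ (𝔬 x).Lap U))
    {dF : ℕ} {αF L₀ Mg Mr ar : ℝ} (hfacts : ∀ x : MemberY θ.d₆ θ.ℓ₆ θ.hd' θ.hL' θ.b₀ θ.b₁ Mstar, Mg ≤ (geo9Y x).M → Facts347 (geo9Y x) (R x) (H x) dF ((1 - 2 * α) * δ₀) αF L₀)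
    (hCB : (const37 d δ₀ α ρ B₀ Nc N' Cℓ K) ≤ B₁) (hCL : (const37 d δ₀ α ρ B₀ Nc N' Cℓ K) * L₀ ≤ B₁) (hδ₁le : δ₁ ≤ (1 - αF) * ((1 - 2 * α) * δ₀)) (hαF : 0 ≤ αF * ((1 - 2 * α) * δ₀))
    (hCg : (const37 d δ₀ α ρ B₀ Nc N' Cℓ K) * B6.c1 dF ((1 - 2 * α) * δ₀) (1 - αF) * L₀ ^ (4 : ℝ) ≤ B₁) (har : 0 < ar)
    (hBβ : ∀ β, 0 ≤ β → β < 1 → holderConst d δ₀ α NH N' (const37 d δ₀ α ρ B₀ Nc N' Cℓ K) (Bl β) (BV β) ≤ Bβ β) (hBL5 : Real.sqrt ((const37 d δ₀ α ρ B₀ Nc N' Cℓ K) * lapConst d δ₀ α NL BL L₀) * L₀ ≤ B₁)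
    (hfacts₀ : ∀ x : MemberY θ.d₆ θ.ℓ₆ θ.hd' θ.hL' θ.b₀ θ.b₁ Mstar, MF ≤ (geo9Y x).M → Facts347 (geo9Y x) (R x) (H x) dL δ₀ α L₀)
    (hrest : ∀ x : MemberY θ.d₆ θ.ℓ₆ θ.hd' θ.hL' θ.b₀ θ.b₁ Mstar, Mr ≤ (geo9Y x).M → ∀ α₀ : ℝ, 0 < α₀ → (geo9Y x).M * α₀ ≤ ar → ∀ U : (bg9Y (Matrix (Fin N) (Fin N) ℂ) (specialUnitaryUnits (Fin N)) x).Cfg, (bg9Y (Matrix (Fin N) (Fin N) ℂ) (specialUnitaryUnits (Fin N)) x).Reg335 c35Y α₀ U →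
      (∀ (ε : ℝ) (lam : (geo9Y x).Loc) (y y' : (geo9Y x).Site), 0 < ε → ε ≤ 1 → (geo9Y x).suppInT lam y' →
          ((opsYOfLetters N θ.toStage3Params Mstar 𝔏 𝔈) x).Gp.e4 U lam y ≤ Bε ε * Real.exp (-(δ₁ * (geo9Y x).dist y y')) * ((geo9Y x).holder ε lam + (geo9Y x).supNorm lam)) ∧
        (∀ (ε β : ℝ) (lam : (geo9Y x).Loc) (ζ : (geo9Y x).Cut) (y y' : (geo9Y x).Site), 0 < ε → ε ≤ 1 → 0 ≤ β → β < 1 → (geo9Y x).cutInT ζ y → (geo9Y x).suppInT lam y' →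
          ((opsYOfLetters N θ.toStage3Params Mstar 𝔏 𝔈) x).Gp.h2 U lam β ζ ≤ Bεβ ε β * ((geo9Y x).len y) ^ (-β) * (geo9Y x).cutH β ζ * Real.exp (-(δ₁ * (geo9Y x).dist y y')) * ((geo9Y x).holder (β + ε) lam + (geo9Y x).supNorm lam)) ∧
        ∀ (lam : (geo9Y x).Loc) (h : (geo9Y x).Cut) (y y' : (geo9Y x).Site), (geo9Y x).cutIn h y → (geo9Y x).suppIn lam y' →
          ((opsYOfLetters N θ.toStage3Params Mstar 𝔏 𝔈) x).Gp.l2 4 U lam h ≤ B₁ * B9.pref6 ((geo9Y x).len y) 4 * (geo9Y x).cutSup h * Real.exp (-(δ₁ * (geo9Y x).dist y y')) * (geo9Y x).l2Norm lam)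
    (hE37 : ∀ x : MemberY θ.d₆ θ.ℓ₆ θ.hd' θ.hL' θ.b₀ θ.b₁ Mstar, ((opsYOfLetters N θ.toStage3Params Mstar 𝔏 𝔈) x).E37 = E37AllOfOps (W38OfOps (𝔬 x) (rd x) (R x) (H x) (const37 d δ₀ α ρ B₀ Nc N' Cℓ K) ((1 - 2 * α) * δ₀)) (𝔬 x) (R x) (H x) (const37 d δ₀ α ρ B₀ Nc N' Cℓ K) ((1 - 2 * α) * δ₀) ((opsYOfLetters N θ.toStage3Params Mstar 𝔏 𝔈) x).Gp B₁ δ₁ Bβ Bε Bεβ)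
    {E7 F7 W7 : MemberY θ.d₆ θ.ℓ₆ θ.hd' θ.hL' θ.b₀ θ.b₁ Mstar → Type} [∀ x, NormedAddCommGroup (E7 x)] [∀ x, InnerProductSpace ℝ (E7 x)] [∀ x, NormedAddCommGroup (F7 x)]
    [∀ x, InnerProductSpace ℝ (F7 x)] [∀ x, NormedAddCommGroup (W7 x)] [∀ x, InnerProductSpace ℝ (W7 x)] [∀ x, FiniteDimensional ℝ (W7 x)]
    (𝔬311 : ∀ x : MemberY θ.d₆ θ.ℓ₆ θ.hd' θ.hL' θ.b₀ θ.b₁ Mstar, Ops311 (bg9Y (Matrix (Fin N) (Fin N) ℂ) (specialUnitaryUnits (Fin N)) x) (E7 x) (F7 x) (W7 x)) (θ311 a311 M311 : ℝ) (ha311 : 0 < a311) (hM311 : 0 < M311)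
    (h311 : ∀ x : MemberY θ.d₆ θ.ℓ₆ θ.hd' θ.hL' θ.b₀ θ.b₁ Mstar, M311 ≤ (geo9Y x).M → ∀ α₀ : ℝ, 0 < α₀ → (geo9Y x).M * α₀ ≤ a311 →
      ∀ U : (bg9Y (Matrix (Fin N) (Fin N) ℂ) (specialUnitaryUnits (Fin N)) x).Cfg, (bg9Y (Matrix (Fin N) (Fin N) ℂ) (specialUnitaryUnits (Fin N)) x).Reg335 c35Y α₀ U → Inputs311 (𝔬311 x) θ311 (geo9Y x).M U)
    (hPD : ∀ x : MemberY θ.d₆ θ.ℓ₆ θ.hd' θ.hL' θ.b₀ θ.b₁ Mstar, ((opsYOfLetters N θ.toStage3Params Mstar 𝔏 𝔈) x).PosDef = PosDefOfOps (𝔬311 x))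
    {X3 Y3 ι3 A3 PX3 PY3 : MemberY θ.d₆ θ.ℓ₆ θ.hd' θ.hL' θ.b₀ θ.b₁ Mstar → Type} [∀ x, Fintype (X3 x)] [∀ x, DecidableEq (X3 x)] [∀ x, Fintype (Y3 x)] [∀ x, DecidableEq (Y3 x)]
    [∀ x, Fintype (ι3 x)] [∀ x, Fintype (A3 x)] [∀ x, Fintype (PX3 x)] [∀ x, DecidableEq (PX3 x)] [∀ x, Fintype (PY3 x)] [∀ x, DecidableEq (PY3 x)]
    (𝔬310 : ∀ x : MemberY θ.d₆ θ.ℓ₆ θ.hd' θ.hL' θ.b₀ θ.b₁ Mstar, Ops310 (geo9Y x) (bg9Y (Matrix (Fin N) (Fin N) ℂ) (specialUnitaryUnits (Fin N)) x) (X3 x) (Y3 x) (ι3 x) (A3 x))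
    (rd310 : ∀ x : MemberY θ.d₆ θ.ℓ₆ θ.hd' θ.hL' θ.b₀ θ.b₁ Mstar, WalkReading310 (geo9Y x) (bg9Y (Matrix (Fin N) (Fin N) ℂ) (specialUnitaryUnits (Fin N)) x) (X3 x) (ι3 x) (A3 x))
    (𝔭3 : ∀ x : MemberY θ.d₆ θ.ℓ₆ θ.hd' θ.hL' θ.b₀ θ.b₁ Mstar, HolderProbes (geo9Y x) (bg9Y (Matrix (Fin N) (Fin N) ℂ) (specialUnitaryUnits (Fin N)) x) (X3 x) (Y3 x) (PX3 x) (PY3 x)) (SH3 SL3 : ∀ x : MemberY θ.d₆ θ.ℓ₆ θ.hd' θ.hL' θ.b₀ θ.b₁ Mstar, ι3 x → Finset (geo9Y x).Site) (Bl3 θH3 : ℝ → ℝ) (NH3 NL3 BL3 MF3 : ℝ) (dL3 : ℕ)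
    (R310 : MemberY θ.d₆ θ.ℓ₆ θ.hd' θ.hL' θ.b₀ θ.b₁ Mstar → ℝ) (H310 : MemberY θ.d₆ θ.ℓ₆ θ.hd' θ.hL' θ.b₀ θ.b₁ Mstar → Prop) (κ310 : MemberY θ.d₆ θ.ℓ₆ θ.hd' θ.hL' θ.b₀ θ.b₁ Mstar → Sizes310)
    (d3 : ℕ) (α3 ρ3 N3 N3' NF3 Cℓ3 K3 θ3 B3 δ3 a3 M3 ML3 : ℝ)
    (hα3 : 0 ≤ α3) (hα3' : α3 ≤ 1 / 2) (hN3 : 0 ≤ N3) (hN3' : 0 ≤ N3') (hNF3 : 0 ≤ NF3) (hCℓ3 : 1 ≤ Cℓ3) (hK3 : 0 ≤ K3) (hθ3 : 0 ≤ θ3) (hB3 : 0 < B3)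
    (hδ3 : 0 < δ3) (ha3 : 0 < a3) (hM3 : 0 < M3) (hNH3 : 0 ≤ NH3) (hNL3 : 0 ≤ NL3) (hBL3 : 0 ≤ BL3) (hst3 : ∀ x, StaticOK310 (𝔬310 x) ρ3 N3 N3' NF3 Cℓ3 (κ310 x)) (hκ3 : ∀ x, (κ310 x).Bounded K3)
    (hrd3 : ∀ x, (rd310 x).OK (𝔬310 x).blk) (hloc3 : ∀ x, Locality310 (𝔬310 x) (rd310 x))
    (h261_3 : ∀ x : MemberY θ.d₆ θ.ℓ₆ θ.hd' θ.hL' θ.b₀ θ.b₁ Mstar, ML3 ≤ (geo9Y x).M → Ineq261 d3 (toB6 (geo9Y x) (R310 x) (H310 x)) δ3 α3)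
    (h36_3 : ∀ x : MemberY θ.d₆ θ.ℓ₆ θ.hd' θ.hL' θ.b₀ θ.b₁ Mstar, M3 ≤ (geo9Y x).M → ∀ α₀ : ℝ, 0 < α₀ → c35Y * (geo9Y x).M * α₀ ≤ a3 →
      ∀ U : (bg9Y (Matrix (Fin N) (Fin N) ℂ) (specialUnitaryUnits (Fin N)) x).Cfg, (bg9Y (Matrix (Fin N) (Fin N) ℂ) (specialUnitaryUnits (Fin N)) x).Reg335 c35Y α₀ U →
        Local342G (𝔬310 x) (R310 x) (H310 x) B3 δ3 U ∧ B9Thm310Whole.Factors389 (𝔬310 x) (R310 x) (H310 x) θ3 δ3 U ∧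
          Identities310 (𝔬310 x) (R310 x) (H310 x) U)
    (h36H3 : ∀ x, M3 ≤ (geo9Y x).M → ∀ α₀ : ℝ, 0 < α₀ → c35Y * (geo9Y x).M * α₀ ≤ a3 → ∀ U : (bg9Y (Matrix (Fin N) (Fin N) ℂ) (specialUnitaryUnits (Fin N)) x).Cfg, (bg9Y (Matrix (Fin N) (Fin N) ℂ) (specialUnitaryUnits (Fin N)) x).Reg335 c35Y α₀ U →
      HolderLegs310 (𝔬310 x) (𝔭3 x) (R310 x) (H310 x) (SH3 x) Bl3 δ3 U ∧ FactorsHolder310 (𝔬310 x) (𝔭3 x) (R310 x) (H310 x) θH3 δ3 U ∧ LapLegs310 (𝔬310 x) (R310 x) (H310 x) (SL3 x) BL3 δ3 U)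
    (hcntH3 : ∀ (x : MemberY θ.d₆ θ.ℓ₆ θ.hd' θ.hL' θ.b₀ θ.b₁ Mstar) (a : (geo9Y x).Site), (∑ q, if a ∈ SH3 x q then (1 : ℝ) else 0) ≤ NH3) (hcntL3 : ∀ (x : MemberY θ.d₆ θ.ℓ₆ θ.hd' θ.hL' θ.b₀ θ.b₁ Mstar) (a : (geo9Y x).Site), (∑ q, if a ∈ SL3 x q then (1 : ℝ) else 0) ≤ NL3)
    (hBl3 : ∀ β, 0 ≤ β → β < 1 → 0 ≤ Bl3 β) (hθH3 : ∀ β, 0 ≤ β → β < 1 → 0 ≤ θH3 β)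
    (ev3 : ∀ x : MemberY θ.d₆ θ.ℓ₆ θ.hd' θ.hL' θ.b₀ θ.b₁ Mstar, (geo9Y x).Loc → X3 x → ℝ) (evY3 : ∀ x : MemberY θ.d₆ θ.ℓ₆ θ.hd' θ.hL' θ.b₀ θ.b₁ Mstar, (geo9Y x).Loc → Y3 x → ℝ)
    (hcoA0 : ∀ x U, CoRealizes ((opsYOfLetters N θ.toStage3Params Mstar 𝔏 𝔈) x).GA 0 U (𝔬310 x).blk (𝔬310 x).blk (ev3 x) ((𝔬310 x).G U)) (hcoA1 : ∀ x U, CoRealizes ((opsYOfLetters N θ.toStage3Params Mstar 𝔏 𝔈) x).GA 1 U (𝔬310 x).blkY (𝔬310 x).blk (ev3 x) ((𝔬310 x).D U ∘ₗ (𝔬310 x).G U))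
    (hcoA2 : ∀ x U, CoRealizes ((opsYOfLetters N θ.toStage3Params Mstar 𝔏 𝔈) x).GA 2 U (𝔬310 x).blk (𝔬310 x).blkY (evY3 x) ((𝔬310 x).G U ∘ₗ (𝔬310 x).Dstar U)) (hcoA3 : ∀ x U, CoRealizes ((opsYOfLetters N θ.toStage3Params Mstar 𝔏 𝔈) x).GA 3 U (𝔬310 x).blk (𝔬310 x).blk (ev3 x) ((𝔬310 x).Lap U ∘ₗ (𝔬310 x).G U))
    (hglA0 : ∀ x U, GlobReads ((opsYOfLetters N θ.toStage3Params Mstar 𝔏 𝔈) x).GA 0 U (𝔬310 x).blk (𝔬310 x).blk (ev3 x) ((𝔬310 x).G U)) (hglA1 : ∀ x U, GlobReads ((opsYOfLetters N θ.toStage3Params Mstar 𝔏 𝔈) x).GA 1 U (𝔬310 x).blkY (𝔬310 x).blk (ev3 x) ((𝔬310 x).D U ∘ₗ (𝔬310 x).G U))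
    (hglA2 : ∀ x U, GlobReads ((opsYOfLetters N θ.toStage3Params Mstar 𝔏 𝔈) x).GA 2 U (𝔬310 x).blk (𝔬310 x).blkY (evY3 x) ((𝔬310 x).G U ∘ₗ (𝔬310 x).Dstar U)) (hglA3 : ∀ x U, GlobReads ((opsYOfLetters N θ.toStage3Params Mstar 𝔏 𝔈) x).GA 3 U (𝔬310 x).blk (𝔬310 x).blk (ev3 x) ((𝔬310 x).Lap U ∘ₗ (𝔬310 x).G U))
    (hlA0 : ∀ x U, L2Reads (R := R310 x) (H := H310 x) ((opsYOfLetters N θ.toStage3Params Mstar 𝔏 𝔈) x).GA 0 U (𝔬310 x).blk (𝔬310 x).blk (ev3 x) ((𝔬310 x).G U)) (hlA1 : ∀ x U, L2Reads (R := R310 x) (H := H310 x) ((opsYOfLetters N θ.toStage3Params Mstar 𝔏 𝔈) x).GA 1 U (𝔬310 x).blkY (𝔬310 x).blk (ev3 x) ((𝔬310 x).D U ∘ₗ (𝔬310 x).G U))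
    (hlA2 : ∀ x U, L2Reads (R := R310 x) (H := H310 x) ((opsYOfLetters N θ.toStage3Params Mstar 𝔏 𝔈) x).GA 2 U (𝔬310 x).blk (𝔬310 x).blkY (evY3 x) ((𝔬310 x).G U ∘ₗ (𝔬310 x).Dstar U)) (hlA3 : ∀ x U, L2Reads (R := R310 x) (H := H310 x) ((opsYOfLetters N θ.toStage3Params Mstar 𝔏 𝔈) x).GA 3 U (𝔬310 x).blk (𝔬310 x).blk (ev3 x) ((𝔬310 x).Lap U ∘ₗ (𝔬310 x).G U))
    (hlA5 : ∀ x U, L2Reads (R := R310 x) (H := H310 x) ((opsYOfLetters N θ.toStage3Params Mstar 𝔏 𝔈) x).GA 5 U (𝔬310 x).blk (𝔬310 x).blk (ev3 x) ((𝔬310 x).G U ∘ₗ (𝔬310 x).Lap U))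
    (hH13 : ∀ x U, H1Reads ((opsYOfLetters N θ.toStage3Params Mstar 𝔏 𝔈) x).GA U (𝔭3 x) (𝔬310 x).blk (𝔬310 x).blkY (ev3 x) (evY3 x) ((𝔬310 x).D U ∘ₗ (𝔬310 x).G U) ((𝔬310 x).G U ∘ₗ (𝔬310 x).Dstar U))
    (hsymA : ∀ x U, IsTransposePair ((𝔬310 x).G U) ((𝔬310 x).G U)) (htrA : ∀ x U, IsTransposePair ((𝔬310 x).D U ∘ₗ (𝔬310 x).G U) ((𝔬310 x).G U ∘ₗ (𝔬310 x).Dstar U)) (hadjLA : ∀ x U, IsTransposePair ((𝔬310 x).Lap U ∘ₗ (𝔬310 x).G U) ((𝔬310 x).G U ∘ₗ (𝔬310 x).Lap U))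
    {dFA : ℕ} {αFA L₀A MgA MrA arA : ℝ}
    (hfactsA : ∀ x : MemberY θ.d₆ θ.ℓ₆ θ.hd' θ.hL' θ.b₀ θ.b₁ Mstar, MgA ≤ (geo9Y x).M → Facts347 (geo9Y x) (R310 x) (H310 x) dFA ((1 - 2 * α3) * δ3) αFA L₀A)
    (hCB3 : (const37 d3 δ3 α3 ρ3 B3 N3 N3' Cℓ3 K3) ≤ B₁) (hCL3 : (const37 d3 δ3 α3 ρ3 B3 N3 N3' Cℓ3 K3) * L₀A ≤ B₁) (hδ₁le3 : δ₁ ≤ (1 - αFA) * ((1 - 2 * α3) * δ3)) (hαFA : 0 ≤ αFA * ((1 - 2 * α3) * δ3))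
    (hCg3 : (const37 d3 δ3 α3 ρ3 B3 N3 N3' Cℓ3 K3) * B6.c1 dFA ((1 - 2 * α3) * δ3) (1 - αFA) * L₀A ^ (4 : ℝ) ≤ B₁) (harA : 0 < arA)
    (hBβ3 : ∀ β, 0 ≤ β → β < 1 → holderConst d3 δ3 α3 NH3 NF3 (const37 d3 δ3 α3 ρ3 B3 N3 N3' Cℓ3 K3) (Bl3 β) (θH3 β) ≤ Bβ β) (hB53 : Real.sqrt ((const37 d3 δ3 α3 ρ3 B3 N3 N3' Cℓ3 K3) * lapConst d3 δ3 α3 NL3 BL3 L₀A) * L₀A ≤ B₁)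
    (hfactsA₀ : ∀ x : MemberY θ.d₆ θ.ℓ₆ θ.hd' θ.hL' θ.b₀ θ.b₁ Mstar, MF3 ≤ (geo9Y x).M → Facts347 (geo9Y x) (R310 x) (H310 x) dL3 δ3 α3 L₀A)
    (hrestA : ∀ x : MemberY θ.d₆ θ.ℓ₆ θ.hd' θ.hL' θ.b₀ θ.b₁ Mstar, MrA ≤ (geo9Y x).M → ∀ α₀ : ℝ, 0 < α₀ → (geo9Y x).M * α₀ ≤ arA → ∀ U : (bg9Y (Matrix (Fin N) (Fin N) ℂ) (specialUnitaryUnits (Fin N)) x).Cfg, (bg9Y (Matrix (Fin N) (Fin N) ℂ) (specialUnitaryUnits (Fin N)) x).Reg335 c35Y α₀ U →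
      (∀ (ε : ℝ) (lam : (geo9Y x).Loc) (y y' : (geo9Y x).Site), 0 < ε → ε ≤ 1 → (geo9Y x).suppInT lam y' →
          ((opsYOfLetters N θ.toStage3Params Mstar 𝔏 𝔈) x).GA.e4 U lam y ≤ Bε ε * Real.exp (-(δ₁ * (geo9Y x).dist y y')) * ((geo9Y x).holder ε lam + (geo9Y x).supNorm lam)) ∧
        (∀ (ε β : ℝ) (lam : (geo9Y x).Loc) (ζ : (geo9Y x).Cut) (y y' : (geo9Y x).Site), 0 < ε → ε ≤ 1 → 0 ≤ β → β < 1 → (geo9Y x).cutInT ζ y → (geo9Y x).suppInT lam y' →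
          ((opsYOfLetters N θ.toStage3Params Mstar 𝔏 𝔈) x).GA.h2 U lam β ζ ≤ Bεβ ε β * ((geo9Y x).len y) ^ (-β) * (geo9Y x).cutH β ζ * Real.exp (-(δ₁ * (geo9Y x).dist y y')) * ((geo9Y x).holder (β + ε) lam + (geo9Y x).supNorm lam)) ∧
        ∀ (lam : (geo9Y x).Loc) (h : (geo9Y x).Cut) (y y' : (geo9Y x).Site), (geo9Y x).cutIn h y → (geo9Y x).suppIn lam y' →
          ((opsYOfLetters N θ.toStage3Params Mstar 𝔏 𝔈) x).GA.l2 4 U lam h ≤ B₁ * B9.pref6 ((geo9Y x).len y) 4 * (geo9Y x).cutSup h * Real.exp (-(δ₁ * (geo9Y x).dist y y')) * (geo9Y x).l2Norm lam)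
    (hE310 : ∀ x : MemberY θ.d₆ θ.ℓ₆ θ.hd' θ.hL' θ.b₀ θ.b₁ Mstar, ((opsYOfLetters N θ.toStage3Params Mstar 𝔏 𝔈) x).E310 = W310OfOps (𝔬310 x) (rd310 x) (ConvAll3107 (𝔬310 x) (R310 x) (H310 x) (const37 d3 δ3 α3 ρ3 B3 N3 N3' Cℓ3 K3) ((1 - 2 * α3) * δ3) ((opsYOfLetters N θ.toStage3Params Mstar 𝔏 𝔈) x).GA B₁ δ₁ Bβ Bε Bεβ))
    {E₁ E₂ : ∀ x : MemberY θ.d₆ θ.ℓ₆ θ.hd' θ.hL' θ.b₀ θ.b₁ Mstar, B9.RWExpansion (geo9Y x) (bg9Y (Matrix (Fin N) (Fin N) ℂ) (specialUnitaryUnits (Fin N)) x)}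
    {termK₁ : ∀ x : MemberY θ.d₆ θ.ℓ₆ θ.hd' θ.hL' θ.b₀ θ.b₁ Mstar, (E₁ x).Walk → B9.KernelFamily (geo9Y x) (bg9Y (Matrix (Fin N) (Fin N) ℂ) (specialUnitaryUnits (Fin N)) x)}
    {termK₂ : ∀ x : MemberY θ.d₆ θ.ℓ₆ θ.hd' θ.hL' θ.b₀ θ.b₁ Mstar, (E₂ x).Walk → B9.KernelFamily (geo9Y x) (bg9Y (Matrix (Fin N) (Fin N) ℂ) (specialUnitaryUnits (Fin N)) x)}
    (X₁ : ∀ x : MemberY θ.d₆ θ.ℓ₆ θ.hd' θ.hL' θ.b₀ θ.b₁ Mstar, (E₁ x).Walk → ℕ → (geo9Y x).Site → Prop) (Meets₁ : ∀ x : MemberY θ.d₆ θ.ℓ₆ θ.hd' θ.hL' θ.b₀ θ.b₁ Mstar, (E₁ x).Walk → ℕ → Prop)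
    (X₂ : ∀ x : MemberY θ.d₆ θ.ℓ₆ θ.hd' θ.hL' θ.b₀ θ.b₁ Mstar, (E₂ x).Walk → ℕ → (geo9Y x).Site → Prop) (Meets₂ : ∀ x : MemberY θ.d₆ θ.ℓ₆ θ.hd' θ.hL' θ.b₀ θ.b₁ Mstar, (E₂ x).Walk → ℕ → Prop)
    (diam : MemberY θ.d₆ θ.ℓ₆ θ.hd' θ.hL' θ.b₀ θ.b₁ Mstar → ℝ) (r₀ : ℝ) (hr : ∀ x, diam x ≤ r₀)
    (near₁ : ∀ (x : MemberY θ.d₆ θ.ℓ₆ θ.hd' θ.hL' θ.b₀ θ.b₁ Mstar) ω m p, Meets₁ x ω m → X₁ x ω m p → ∃ q, q ∈ OmegaC x.D x.D' ∧ tdistK (ℓ := θ.ℓ₆) (Mh := x.Mh) (k := x.k) (P := x.P') (kLab x p) q ≤ diam x)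
    (first_mem₁ : ∀ (x : MemberY θ.d₆ θ.ℓ₆ θ.hd' θ.hL' θ.b₀ θ.b₁ Mstar) ω y, (E₁ x).first ω y → X₁ x ω 0 y)
    (chain₁ : ∀ (x : MemberY θ.d₆ θ.ℓ₆ θ.hd' θ.hL' θ.b₀ θ.b₁ Mstar) ω y y', (E₁ x).first ω y → (E₁ x).last ω y' → ∃ l : List (geo9Y x).Site, l.length = (E₁ x).wlen ω ∧
      (∀ (m : ℕ) (hm : m < l.length), X₁ x ω (m + 1) (l[m])) ∧ B9Thm314.chainSum (geo9Y x).dist y l y' ≤ (E₁ x).wdist ω y y')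
    (near₂ : ∀ (x : MemberY θ.d₆ θ.ℓ₆ θ.hd' θ.hL' θ.b₀ θ.b₁ Mstar) ω m p, Meets₂ x ω m → X₂ x ω m p → ∃ q, q ∈ OmegaC x.D x.D' ∧ tdistK (ℓ := θ.ℓ₆) (Mh := x.Mh) (k := x.k) (P := x.P') (kLab x p) q ≤ diam x)
    (first_mem₂ : ∀ (x : MemberY θ.d₆ θ.ℓ₆ θ.hd' θ.hL' θ.b₀ θ.b₁ Mstar) ω y, (E₂ x).first ω y → X₂ x ω 0 y)
    (chain₂ : ∀ (x : MemberY θ.d₆ θ.ℓ₆ θ.hd' θ.hL' θ.b₀ θ.b₁ Mstar) ω y y', (E₂ x).first ω y → (E₂ x).last ω y' → ∃ l : List (geo9Y x).Site, l.length = (E₂ x).wlen ω ∧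
      (∀ (m : ℕ) (hm : m < l.length), X₂ x ω (m + 1) (l[m])) ∧ B9Thm314.chainSum (geo9Y x).dist y l y' ≤ (E₂ x).wdist ω y y')
    (h₁ : Thm310AllNormsPrinted c35Y geo9Y (bg9Y (Matrix (Fin N) (Fin N) ℂ) (specialUnitaryUnits (Fin N))) E₁ termK₁) (h₂ : Thm310AllNormsPrinted c35Y geo9Y (bg9Y (Matrix (Fin N) (Fin N) ℂ) (specialUnitaryUnits (Fin N))) E₂ termK₂)
    (W : ∀ x : MemberY θ.d₆ θ.ℓ₆ θ.hd' θ.hL' θ.b₀ θ.b₁ Mstar, ℕ → (geo9Y x).Site → (geo9Y x).Site → Finset (pairExpansion (E₁ x) (E₂ x) (locDataY x (E₁ x) (X₁ x) (Meets₁ x) (diam x)).Touches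
      (locData₂ (locDataY x (E₁ x) (X₁ x) (Meets₁ x) (diam x)) (X₂ x) (Meets₂ x)).Touches).Walk)
    (hW : ∀ x, WalkSetsSpec (pairExpansion (E₁ x) (E₂ x) (locDataY x (E₁ x) (X₁ x) (Meets₁ x) (diam x)).Touches
      (locData₂ (locDataY x (E₁ x) (X₁ x) (Meets₁ x) (diam x)) (X₂ x) (Meets₂ x)).Touches) (W x))
    (hcnt : WalkWeightsSummable geo9Y (bg9Y (Matrix (Fin N) (Fin N) ℂ) (specialUnitaryUnits (Fin N))) (fun x => pairExpansion (E₁ x) (E₂ x)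
      (locDataY x (E₁ x) (X₁ x) (Meets₁ x) (diam x)).Touches (locData₂ (locDataY x (E₁ x) (X₁ x) (Meets₁ x) (diam x)) (X₂ x) (Meets₂ x)).Touches) W)
    (hdom : ∀ (x : MemberY θ.d₆ θ.ℓ₆ θ.hd' θ.hL' θ.b₀ θ.b₁ Mstar) (U : (bg9Y (Matrix (Fin N) (Fin N) ℂ) (specialUnitaryUnits (Fin N)) x).Cfg), (E₁ x).Converges U ∧ (E₂ x).Converges U →
      DominatedBySums (pairExpansion (E₁ x) (E₂ x) (locDataY x (E₁ x) (X₁ x) (Meets₁ x) (diam x)).Touches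
          (locData₂ (locDataY x (E₁ x) (X₁ x) (Meets₁ x) (diam x)) (X₂ x) (Meets₂ x)).Touches)
        (pairTermK (E₁ x) (E₂ x) _ _ (termK₁ x) (termK₂ x)) ((opsYOfLetters N θ.toStage3Params Mstar 𝔏 𝔈) x).Kdiff (W x) U)
    {𝔸5 : Type} [NormedRing 𝔸5] {P5 W5 : MemberY θ.d₆ θ.ℓ₆ θ.hd' θ.hL' θ.b₀ θ.b₁ Mstar → Type} [∀ x, Fintype (P5 x)]
    (𝔬315 : ∀ x : MemberY θ.d₆ θ.ℓ₆ θ.hd' θ.hL' θ.b₀ θ.b₁ Mstar, Ops315 (geo9Y x) (bg9Y (Matrix (Fin N) (Fin N) ℂ) (specialUnitaryUnits (Fin N)) x) 𝔸5 (P5 x) (W5 x)) {K5 r5 m5 a5 δ5 B5 : ℝ}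
    (hK5 : 0 < K5) (hm5 : 0 < m5) (ha5 : 0 < a5) (hδ5 : 0 < δ5) (hB5 : 0 < B5)
    (hR5 : ∀ x : MemberY θ.d₆ θ.ℓ₆ θ.hd' θ.hL' θ.b₀ θ.b₁ Mstar, Reads315 (𝔬315 x) ((opsYOfLetters N θ.toStage3Params Mstar 𝔏 𝔈) x).Ck (inΛY x) K5) (hS5 : ∀ x : MemberY θ.d₆ θ.ℓ₆ θ.hd' θ.hL' θ.b₀ θ.b₁ Mstar, Static315 (𝔬315 x) (unitDistY x) r5 m5)
    (h315 : ∀ (x : MemberY θ.d₆ θ.ℓ₆ θ.hd' θ.hL' θ.b₀ θ.b₁ Mstar) (α₀ : ℝ), 0 < α₀ → (geo9Y x).M * α₀ ≤ a5 →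
      ∀ U : (bg9Y (Matrix (Fin N) (Fin N) ℂ) (specialUnitaryUnits (Fin N)) x).Cfg, (bg9Y (Matrix (Fin N) (Fin N) ℂ) (specialUnitaryUnits (Fin N)) x).Reg335 c35Y α₀ U → (bg9Y (Matrix (Fin N) (Fin N) ℂ) (specialUnitaryUnits (Fin N)) x).Reg336 c35Y α₀ U →
        GivenBy3185OfOps (𝔬315 x) U ∧ HasRWExpCOfOps (𝔬315 x) (unitDistY x) B5 U δ5)
    (hG315 : ∀ (x : MemberY θ.d₆ θ.ℓ₆ θ.hd' θ.hL' θ.b₀ θ.b₁ Mstar) (U : (bg9Y (Matrix (Fin N) (Fin N) ℂ) (specialUnitaryUnits (Fin N)) x).Cfg), GivenBy3185OfOps (𝔬315 x) U → ((opsYOfLetters N θ.toStage3Params Mstar 𝔏 𝔈) x).GivenBy3185 U)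
    (hH315 : ∀ (x : MemberY θ.d₆ θ.ℓ₆ θ.hd' θ.hL' θ.b₀ θ.b₁ Mstar) (U : (bg9Y (Matrix (Fin N) (Fin N) ℂ) (specialUnitaryUnits (Fin N)) x).Cfg) (δ' : ℝ), HasRWExpCOfOps (𝔬315 x) (unitDistY x) B5 U δ' → ((opsYOfLetters N θ.toStage3Params Mstar 𝔏 𝔈) x).HasRWExpC U δ')
    {X12 Y12 Z12 W12 : MemberY θ.d₆ θ.ℓ₆ θ.hd' θ.hL' θ.b₀ θ.b₁ Mstar → Type} [∀ x, Fintype (X12 x)] [∀ x, DecidableEq (X12 x)] [∀ x, Fintype (Y12 x)] [∀ x, Fintype (Z12 x)]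
    [∀ x, Fintype (W12 x)]
    (𝔬12 : ∀ x : MemberY θ.d₆ θ.ℓ₆ θ.hd' θ.hL' θ.b₀ θ.b₁ Mstar, B9Thm312Whole.Ops (geo9Y x) (bg9Y (Matrix (Fin N) (Fin N) ℂ) (specialUnitaryUnits (Fin N)) x) (X12 x) (Y12 x) (Z12 x) (W12 x)) (R12 : MemberY θ.d₆ θ.ℓ₆ θ.hd' θ.hL' θ.b₀ θ.b₁ Mstar → ℝ) (H12 : MemberY θ.d₆ θ.ℓ₆ θ.hd' θ.hL' θ.b₀ θ.b₁ Mstar → Prop)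
    (ev12 : ∀ x : MemberY θ.d₆ θ.ℓ₆ θ.hd' θ.hL' θ.b₀ θ.b₁ Mstar, (geo9Y x).Loc → X12 x → ℝ) (evY12 : ∀ x : MemberY θ.d₆ θ.ℓ₆ θ.hd' θ.hL' θ.b₀ θ.b₁ Mstar, (geo9Y x).Loc → Y12 x → ℝ)
    (θ12 r12 B12₀ δ12₀ δK12 σ12 ρ12 a12 M12 B12₁ δ12₁ : ℝ) (Bβ12 Bε12 : ℝ → ℝ) (Bεβ12 : ℝ → ℝ → ℝ)
    (hθ12 : 0 ≤ θ12) (hr12 : 0 ≤ r12) (hB12₀ : 0 ≤ B12₀) (hρ12 : 0 < ρ12) (hρS12 : ρ12 ≤ δ12₀) (hρδ12 : ρ12 + σ12 ≤ δK12) (hσ12 : 0 < σ12)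
    (ha12 : 0 < a12) (hM12 : 0 < M12) (hB12₁ : 0 ≤ B12₁) (hδ12₁ : 0 < δ12₁) (hBβ12 : ∀ β, 0 ≤ Bβ12 β) (hBε12 : ∀ ε, 0 ≤ Bε12 ε) (hBεβ12 : ∀ ε β, 0 ≤ Bεβ12 ε β)
    (hco12 : ∀ (x : MemberY θ.d₆ θ.ℓ₆ θ.hd' θ.hL' θ.b₀ θ.b₁ Mstar) (U : (bg9Y (Matrix (Fin N) (Fin N) ℂ) (specialUnitaryUnits (Fin N)) x).Cfg),
      CoRealizes ((opsYOfLetters N θ.toStage3Params Mstar 𝔏 𝔈) x).GD 0 U (𝔬12 x).blk (𝔬12 x).blk (ev12 x) ((𝔬12 x).G U) ∧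
      CoRealizes ((opsYOfLetters N θ.toStage3Params Mstar 𝔏 𝔈) x).GD 2 U (𝔬12 x).blk (𝔬12 x).blkY (evY12 x) ((𝔬12 x).G U ∘ₗ (𝔬12 x).Dstar U) ∧
      CoRealizes ((opsYOfLetters N θ.toStage3Params Mstar 𝔏 𝔈) x).G₁ 0 U (𝔬12 x).blk (𝔬12 x).blk (ev12 x) ((𝔬12 x).G1 U) ∧
      CoRealizes ((opsYOfLetters N θ.toStage3Params Mstar 𝔏 𝔈) x).G₁ 2 U (𝔬12 x).blk (𝔬12 x).blkY (evY12 x) ((𝔬12 x).G1 U ∘ₗ (𝔬12 x).Dstar U))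
    (hmodel12 : ∀ x : MemberY θ.d₆ θ.ℓ₆ θ.hd' θ.hL' θ.b₀ θ.b₁ Mstar, M12 ≤ (geo9Y x).M → ∀ α₀ : ℝ, 0 < α₀ → (geo9Y x).M * α₀ ≤ a12 →
      ∀ U : (bg9Y (Matrix (Fin N) (Fin N) ℂ) (specialUnitaryUnits (Fin N)) x).Cfg, (bg9Y (Matrix (Fin N) (Fin N) ℂ) (specialUnitaryUnits (Fin N)) x).Reg335 c35Y α₀ U → (bg9Y (Matrix (Fin N) (Fin N) ℂ) (specialUnitaryUnits (Fin N)) x).Reg336 c35Y α₀ U →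
        Thm33G0 (𝔬12 x) (R12 x) (H12 x) B12₀ δ12₀ U ∧
        B9Thm312Whole.Step (𝔬12 x) (R12 x) (H12 x) (fun y => (geo9Y_len_pos x y).le) 1 (θ12 * ((geo9Y x).M * α₀)) δK12 U ∧
        B9Thm312Whole.Step (𝔬12 x) (R12 x) (H12 x) (fun y => (geo9Y_len_pos x y).le) 2 (θ12 * ((geo9Y x).M * α₀)) δK12 U ∧
        FormSmall (𝔬12 x) (r12 * ((geo9Y x).M * α₀)) U ∧ B9Thm312Whole.Identities (𝔬12 x) U)
    (hres12 : ∀ x : MemberY θ.d₆ θ.ℓ₆ θ.hd' θ.hL' θ.b₀ θ.b₁ Mstar, M12 ≤ (geo9Y x).M → ∀ α₀ : ℝ, 0 < α₀ → (geo9Y x).M * α₀ ≤ a12 →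
      ∀ U : (bg9Y (Matrix (Fin N) (Fin N) ℂ) (specialUnitaryUnits (Fin N)) x).Cfg, (bg9Y (Matrix (Fin N) (Fin N) ℂ) (specialUnitaryUnits (Fin N)) x).Reg335 c35Y α₀ U → (bg9Y (Matrix (Fin N) (Fin N) ℂ) (specialUnitaryUnits (Fin N)) x).Reg336 c35Y α₀ U →
        (∀ K ∈ [((opsYOfLetters N θ.toStage3Params Mstar 𝔏 𝔈) x).GD, ((opsYOfLetters N θ.toStage3Params Mstar 𝔏 𝔈) x).G₁], Clause342 K 1 B12₁ δ12₁ U ∧ L2Block K B12₁ δ12₁ U ∧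
          (∀ (n : Fin 4) (lam : (geo9Y x).Loc) (γ : ℝ), n ≠ 3 → -4 ≤ γ → γ ≤ 4 →
            K.glob n U lam γ ≤ B12₁ * (geo9Y x).wNorm γ lam) ∧
          B9.Ineq343_345 K Bβ12 Bε12 Bεβ12 δ12₁ U) ∧
        (∀ Hk' ∈ [((opsYOfLetters N θ.toStage3Params Mstar 𝔏 𝔈) x).H, ((opsYOfLetters N θ.toStage3Params Mstar 𝔏 𝔈) x).H₁], B9.Ineq3133 (θ.d₆ + 1) Hk' B12₁ Bβ12 δ12₁ U))
    (hpinE : ∀ x : MemberY θ.d₆ θ.ℓ₆ θ.hd' θ.hL' θ.b₀ θ.b₁ Mstar, ((opsYOfLetters N θ.toStage3Params Mstar 𝔏 𝔈) x).HasRWExp = HasRWExpOfOps (𝔬12 x))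
    (hpinH : ∀ x : MemberY θ.d₆ θ.ℓ₆ θ.hd' θ.hL' θ.b₀ θ.b₁ Mstar, ((opsYOfLetters N θ.toStage3Params Mstar 𝔏 𝔈) x).HasRWExpH = HasRWExpHOfOps (𝔬12 x))
    (hpinK : ∀ x : MemberY θ.d₆ θ.ℓ₆ θ.hd' θ.hL' θ.b₀ θ.b₁ Mstar, ((opsYOfLetters N θ.toStage3Params Mstar 𝔏 𝔈) x).PosDefK = PosDefKOfOps (𝔬12 x))
    (B13 δ13 ρ13 : ℝ) (hB13 : 0 ≤ B13) (hρ13 : 0 < ρ13) (hρ13ρ : ρ13 + 3 * σ12 ≤ ρ12) (hρδ13 : ρ12 ≤ δ13)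
    (hco13 : ∀ (x : MemberY θ.d₆ θ.ℓ₆ θ.hd' θ.hL' θ.b₀ θ.b₁ Mstar) (U : (bg9Y (Matrix (Fin N) (Fin N) ℂ) (specialUnitaryUnits (Fin N)) x).Cfg),
      CoRealizes ((opsYOfLetters N θ.toStage3Params Mstar 𝔏 𝔈) x).GG 0 U (𝔬12 x).blk (𝔬12 x).blk (ev12 x) ((𝔬12 x).GG U) ∧
      CoRealizes ((opsYOfLetters N θ.toStage3Params Mstar 𝔏 𝔈) x).GG 2 U (𝔬12 x).blk (𝔬12 x).blkY (evY12 x) ((𝔬12 x).GG U ∘ₗ (𝔬12 x).Dstar U))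
    (hletters13 : ∀ x : MemberY θ.d₆ θ.ℓ₆ θ.hd' θ.hL' θ.b₀ θ.b₁ Mstar, M12 ≤ (geo9Y x).M → ∀ α₀ : ℝ, 0 < α₀ → (geo9Y x).M * α₀ ≤ a12 →
      ∀ U : (bg9Y (Matrix (Fin N) (Fin N) ℂ) (specialUnitaryUnits (Fin N)) x).Cfg, (bg9Y (Matrix (Fin N) (Fin N) ℂ) (specialUnitaryUnits (Fin N)) x).Reg335 c35Y α₀ U → (bg9Y (Matrix (Fin N) (Fin N) ℂ) (specialUnitaryUnits (Fin N)) x).Reg336 c35Y α₀ U →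
        Letters313 (𝔬12 x) (R12 x) (H12 x) ⟨geo9Y_dist_triangle x, geo9Y_dist_comm x, geo9K_dist_nonneg x.toKIdx, geo9Y_len_pos x⟩ B13 δ13 U)
    (hres13 : ∀ x : MemberY θ.d₆ θ.ℓ₆ θ.hd' θ.hL' θ.b₀ θ.b₁ Mstar, M12 ≤ (geo9Y x).M → ∀ α₀ : ℝ, 0 < α₀ → (geo9Y x).M * α₀ ≤ a12 →
      ∀ U : (bg9Y (Matrix (Fin N) (Fin N) ℂ) (specialUnitaryUnits (Fin N)) x).Cfg, (bg9Y (Matrix (Fin N) (Fin N) ℂ) (specialUnitaryUnits (Fin N)) x).Reg335 c35Y α₀ U → (bg9Y (Matrix (Fin N) (Fin N) ℂ) (specialUnitaryUnits (Fin N)) x).Reg336 c35Y α₀ U →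
        Clause342 ((opsYOfLetters N θ.toStage3Params Mstar 𝔏 𝔈) x).GG 1 B12₁ δ12₁ U ∧ L2Block ((opsYOfLetters N θ.toStage3Params Mstar 𝔏 𝔈) x).GG B12₁ δ12₁ U ∧
          (∀ (n : Fin 4) (lam : (geo9Y x).Loc) (γ : ℝ), n ≠ 3 → -4 ≤ γ → γ ≤ 4 →
            (((opsYOfLetters N θ.toStage3Params Mstar 𝔏 𝔈) x).GG).glob n U lam γ ≤ B12₁ * (geo9Y x).wNorm γ lam) ∧
          B9.Ineq343_345 ((opsYOfLetters N θ.toStage3Params Mstar 𝔏 𝔈) x).GG Bβ12 Bε12 Bεβ12 δ12₁ U)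
    (hdict : ∀ x : MemberY θ.d₆ θ.ℓ₆ θ.hd' θ.hL' θ.b₀ θ.b₁ Mstar, Dict349 ((opsYOfLetters N θ.toStage3Params Mstar 𝔏 𝔈) x).Gp ((opsYOfLetters N θ.toStage3Params Mstar 𝔏 𝔈) x).Cinv ((opsYOfLetters N θ.toStage3Params Mstar 𝔏 𝔈) x).P349)
    (P : B12.RunParams) : Dag.B9_main (leavesP w P) := by
  have hL1 : (1 : ℝ) ≤ ((θ.ℓ₆ + 1 : ℕ) : ℝ) := by exact_mod_cast Nat.succ_le_succ (Nat.zero_le _)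
  have t311 := t311_of_pin θ.toStage3Params Mstar (opsYOfLetters N θ.toStage3Params Mstar 𝔏 𝔈) 𝔬311 θ311 a311 M311 ha311 hM311 h311 hPD
  have t315 := t315_of_pins θ.toStage3Params Mstar (opsYOfLetters N θ.toStage3Params Mstar 𝔏 𝔈) 𝔬315 hK5 hm5 ha5 hδ5 hB5 hR5 hS5 h315 hG315 hH315
  have hGp_e := hGp_e_opsYOfLetters N θ.toStage3Params Mstar 𝔏 𝔈
  have hGp_h1 := hGp_h1_opsYOfLetters N θ.toStage3Params Mstar 𝔏 𝔈
  have hC := hC_opsYOfLetters N θ.toStage3Params Mstar 𝔏 𝔈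
  have hGA_e := hGA_e_opsYOfLetters N θ.toStage3Params Mstar 𝔏 𝔈
  have hGA_h1 := hGA_h1_opsYOfLetters N θ.toStage3Params Mstar 𝔏 𝔈
  have hGA_e4 := hGA_e4_opsYOfLetters N θ.toStage3Params Mstar 𝔏 𝔈
  have hGA_h2 := hGA_h2_opsYOfLetters N θ.toStage3Params Mstar 𝔏 𝔈
  have hGA_l2 := hGA_l2_opsYOfLetters N θ.toStage3Params Mstar 𝔏 𝔈
  have hGp := hGp_opsYOfLetters_of_leaves5 N θ.toStage3Params Mstar 𝔏 𝔈 hGpL3 hGpL4 hGpL5 hGpE4 hGpH2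
  have hGA := hGA_opsYOfLetters N θ.toStage3Params Mstar 𝔏 𝔈
  obtain ⟨t39, hksum⟩ := t39_hksum_of_pin_rowConst261 (opsYOfLetters N θ.toStage3Params Mstar 𝔏 𝔈) 𝔬39 rd39 (θ.d₆ + 1) α39 α' r39 δ39 θ39 B39 N39 a39 M39 c35Y_pos h39α h39α1 hα'0
    hα'1 hr39 hrδ39 hθ39 hB39 hN39 ha39 hM39 hst39 hloc39 h39 hEK39 hrdC
  have s3132 := s3132_of_inputs θ.toStage3Params Mstar (opsYOfLetters N θ.toStage3Params Mstar 𝔏 𝔈) hCT hCT₁ hN32 hN32₁ hA32 hwt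
  have hgeoOK : ∀ x : MemberY θ.d₆ θ.ℓ₆ θ.hd' θ.hL' θ.b₀ θ.b₁ Mstar, GeoOK (geo9Y x) := fun x => ⟨geo9Y_dist_triangle x, geo9Y_dist_comm x, geo9K_dist_nonneg x.toKIdx, geo9Y_len_pos x⟩
  obtain ⟨ML12, c12, hrow12⟩ := rowSum261_geo9Y (d := θ.d₆) (ℓ := θ.ℓ₆) (hd := θ.hd') (hL := θ.hL') (b₀ := θ.b₀) (b₁ := θ.b₁) (Mstar := Mstar) σ12 hσ12
  have hrow : ∀ x : MemberY θ.d₆ θ.ℓ₆ θ.hd' θ.hL' θ.b₀ θ.b₁ Mstar, ML12 ≤ (geo9Y x).M → RowSum (toB6 (geo9Y x) (R12 x) (H12 x)) σ12 (max c12 0) := fun x hM y => (hrow12 x hM y).trans (le_max_left _ _)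
  have hE : (fun x => ((opsYOfLetters N θ.toStage3Params Mstar 𝔏 𝔈) x).HasRWExp) = fun x => HasRWExpOfOps (𝔬12 x) := funext hpinE
  have hH : (fun x => ((opsYOfLetters N θ.toStage3Params Mstar 𝔏 𝔈) x).HasRWExpH) = fun x => HasRWExpHOfOps (𝔬12 x) := funext hpinH
  have hK' : (fun x => ((opsYOfLetters N θ.toStage3Params Mstar 𝔏 𝔈) x).PosDefK) = fun x => PosDefKOfOps (𝔬12 x) := funext hpinK
  have t312 : B9.Thm312Printed (θ.d₆ + 1) c35Y geo9Y (bg9Y (Matrix (Fin N) (Fin N) ℂ) (specialUnitaryUnits (Fin N))) (fun x => ((opsYOfLetters N θ.toStage3Params Mstar 𝔏 𝔈) x).GD) (fun x => ((opsYOfLetters N θ.toStage3Params Mstar 𝔏 𝔈) x).G₁)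
      (fun x => ((opsYOfLetters N θ.toStage3Params Mstar 𝔏 𝔈) x).H) (fun x => ((opsYOfLetters N θ.toStage3Params Mstar 𝔏 𝔈) x).H₁) (fun x => ((opsYOfLetters N θ.toStage3Params Mstar 𝔏 𝔈) x).HasRWExp) (fun x => ((opsYOfLetters N θ.toStage3Params Mstar 𝔏 𝔈) x).HasRWExpH)
      (fun x => ((opsYOfLetters N θ.toStage3Params Mstar 𝔏 𝔈) x).PosDefK) := by
    rw [hE, hH, hK']
    exact thm312Printed_of_step 𝔬12 R12 H12 (fun x => ((opsYOfLetters N θ.toStage3Params Mstar 𝔏 𝔈) x).GD) (fun x => ((opsYOfLetters N θ.toStage3Params Mstar 𝔏 𝔈) x).G₁) (fun x => ((opsYOfLetters N θ.toStage3Params Mstar 𝔏 𝔈) x).H)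
      (fun x => ((opsYOfLetters N θ.toStage3Params Mstar 𝔏 𝔈) x).H₁) ev12 evY12 θ12 r12 B12₀ δ12₀ δK12 σ12 (max c12 0) ρ12 a12 M12 ML12 B12₁ δ12₁ Bβ12 Bε12 Bεβ12 hθ12 hr12 hB12₀ hρ12 hρS12
      hρδ12 (le_max_right _ _) ha12 hM12 hB12₁ hδ12₁ hBβ12 hBε12 hBεβ12 hgeoOK (fun x => modelSignsOn_geo9K x.toKIdx) hrow hco12 hmodel12 hres12
  have t313 : B9.Thm313Printed c35Y geo9Y (bg9Y (Matrix (Fin N) (Fin N) ℂ) (specialUnitaryUnits (Fin N))) (fun x => ((opsYOfLetters N θ.toStage3Params Mstar 𝔏 𝔈) x).GG) (fun x => ((opsYOfLetters N θ.toStage3Params Mstar 𝔏 𝔈) x).HasRWExp) (fun x => ((opsYOfLetters N θ.toStage3Params Mstar 𝔏 𝔈) x).PosDefK) := by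
    rw [hE, hK']
    exact thm313Printed_of_step 𝔬12 R12 H12 (fun x => ((opsYOfLetters N θ.toStage3Params Mstar 𝔏 𝔈) x).GG) ev12 evY12 θ12 r12 B12₀ δ12₀ δK12 σ12 (max c12 0) ρ12 a12 M12 ML12 B12₁ δ12₁ B13
      δ13 ρ13 Bβ12 Bε12 Bεβ12 hθ12 hr12 hB12₀ hB13 hσ12.le hρ13 hρ13ρ hρS12 hρδ13 hρδ12 (le_max_right _ _) ha12 hM12 hB12₁ hδ12₁ hBβ12 hBε12 hBεβ12 hgeoOK
      (fun x => modelSignsOn_geo9K x.toKIdx) hrow hco13 hmodel12 hletters13 hres13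
  have hE4 := hE4_of_hGA_e4 (opsYOfLetters N θ.toStage3Params Mstar 𝔏 𝔈) hGA_e4
  have hH2 := hH2_of_hGA_h2 (opsYOfLetters N θ.toStage3Params Mstar 𝔏 𝔈) hGA_h2
  have hB := hB_obligation_of_memberSteps θ.toStage3Params Mstar (opsYOfLetters N θ.toStage3Params Mstar 𝔏 𝔈) hA hEp hLp hGlp hH1p hE4p hH2p hK hEa hLa hGla hH1a hE4a hH2a
  have hg := hg_obligation_vacuous θ.toStage3Params Mstar (opsYOfLetters N θ.toStage3Params Mstar 𝔏 𝔈)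
  have t37 := t37_of_allPin_lap θ.toStage3Params Mstar (opsYOfLetters N θ.toStage3Params Mstar 𝔏 𝔈) 𝔬 rd 𝔭 SH SL Bl BV NH NL BL MF dL R H κ d α ρ Nc N' Cℓ K θ₀ B₀ δ₀ a₁ M₁ ML hα hα2 hN
    hN' hCℓ hK0 hB₀.le hδ₀.le ha₁ hM₁ hNH hNL hBL hst hκ h261 h36 h36H hcntH hcntL hBl hBV (fun x => (rd x).ev) evY hco0 hco1 hco2 hco3 hgl0 hgl1 hgl2 hgl3 hl0 hl1 hl2 hl3 hl5 hH1
    hsym htr hadjL hfacts hCB hCL hδ₁le hαF hCg har hBβ hBL5 hfacts₀ hrest hE37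
  have hα1 : α < 1 := by linarith
  have c38 := c38_of_allPin θ.toStage3Params Mstar (opsYOfLetters N θ.toStage3Params Mstar 𝔏 𝔈) 𝔬 rd R H κ d α ρ Nc N' Cℓ K θ₀ B₀ δ₀ a₁ M₁ ML hα hα1 hθ₀ hB₀ hδ₀ ha₁ hM₁ hst hκ hrd hloc h261 h36 hE37
  have t310 := t310_of_allPin_lap θ.toStage3Params Mstar (opsYOfLetters N θ.toStage3Params Mstar 𝔏 𝔈) 𝔬310 rd310 𝔭3 SH3 SL3 Bl3 θH3 NH3 NL3 BL3 MF3 dL3 R310 H310 κ310 d3 α3 ρ3 N3 N3' NF3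
    Cℓ3 K3 θ3 B3 δ3 a3 M3 ML3 hα3 hα3' hN3 hN3' hNF3 hCℓ3 hK3 hθ3 hB3 hδ3 ha3 hM3 hNH3 hNL3 hBL3 hst3 hκ3 hrd3 hloc3 h261_3 h36_3 h36H3 hcntH3 hcntL3 hBl3 hθH3 ev3 evY3 hcoA0
    hcoA1 hcoA2 hcoA3 hglA0 hglA1 hglA2 hglA3 hlA0 hlA1 hlA2 hlA3 hlA5 hH13 hsymA htrA hadjLA hfactsA hCB3 hCL3 hδ₁le3 hαFA hCg3 harA hBβ3 hB53 hfactsA₀ hrestA hE310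
  have hsum := hsum_of_allPins θ.toStage3Params Mstar (opsYOfLetters N θ.toStage3Params Mstar 𝔏 𝔈) 𝔬 rd R H (const37 d δ₀ α ρ B₀ Nc N' Cℓ K) ((1 - 2 * α) * δ₀) 𝔬310 rd310 R310 H310 (const37 d3 δ3 α3 ρ3 B3 N3 N3' Cℓ3 K3) ((1 - 2 * α3) * δ3) Bβ Bε Bεβ hB₁ hδ₁ hE37 hE310
  obtain ⟨t314, t314loc⟩ := thm314_pair_of_pair_reading (c35 := c35Y) (geo := geo9Y) (bg := bg9Y (Matrix (Fin N) (Fin N) ℂ) (specialUnitaryUnits (Fin N)))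
    (Kdiff := fun x => ((opsYOfLetters N θ.toStage3Params Mstar 𝔏 𝔈) x).Kdiff) (OmK := OmKY) (dOmega := dOmegaY)
    (fun x => locDataY x (E₁ x) (X₁ x) (Meets₁ x) (diam x)) X₂ Meets₂ (fun x => locDataY_laws x (E₁ x) (near₁ x) (first_mem₁ x) (chain₁ x))
    (fun x => locDataY_laws x (E₂ x) (near₂ x) (first_mem₂ x) (chain₂ x)) r₀ hr (fun x => modelSignsOn_geo9K x.toKIdx) dOmegaY_nonneg h₁ h₂ W hW hcnt hdom
  have h31 := B9.thm31_of_thm37 c35Y geo9Y (bg9Y (Matrix (Fin N) (Fin N) ℂ) (specialUnitaryUnits (Fin N))) (fun x => ((opsYOfLetters N θ.toStage3Params Mstar 𝔏 𝔈) x).E37) (fun x => ((opsYOfLetters N θ.toStage3Params Mstar 𝔏 𝔈) x).E310) (fun x => ((opsYOfLetters N θ.toStage3Params Mstar 𝔏 𝔈) x).Gp)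
    (fun x => ((opsYOfLetters N θ.toStage3Params Mstar 𝔏 𝔈) x).GA) t37 hsum
  have h32 := B9.thm32_of_thm39 (θ.d₆ + 1) c35Y geo9Y (bg9Y (Matrix (Fin N) (Fin N) ℂ) (specialUnitaryUnits (Fin N))) (fun x => ((opsYOfLetters N θ.toStage3Params Mstar 𝔏 𝔈) x).EK39) (fun x => ((opsYOfLetters N θ.toStage3Params Mstar 𝔏 𝔈) x).Cinv) t39 hksum
  have s349 : B9.Stmt349Printed (θ.d₆ + 1) c35Y geo9Y (bg9Y (Matrix (Fin N) (Fin N) ℂ) (specialUnitaryUnits (Fin N))) (fun x => ((opsYOfLetters N θ.toStage3Params Mstar 𝔏 𝔈) x).P349) :=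
    stmt349Printed_of_thm31_thm32 (geo := geo9Y) (bg := (bg9Y (Matrix (Fin N) (Fin N) ℂ) (specialUnitaryUnits (Fin N)))) (θ.d₆ + 1) h31 h32 (Q := fun _ lam => lam.isRight = true)
      (fun x => modelSignsOn_geo9K x.toKIdx) (fun x => distOK_geo9Y x) hL1 (fun _ => rfl) one_pos levelGap_geo9Y_one rowSum261_geo9Y hdict
  exact b9_main_of_up_view₁₁B10YZW_of_obligations θ hθ Mstar (opsYOfLetters N θ.toStage3Params Mstar 𝔏 𝔈) ζ lamW w hup hGp_e hGp_h1 hC hGA_e hGA_h1 hGA_e4 hGA_h2 hGA_l2 hE4 hH2 hGp hGA hB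
    hg t37 c38 t39 t310 hsum hksum t311 t312 t313 t314 t315 s349 s3132 t314loc P

end Pointed

end Summit.QuantumFields.YangMills.BalabanUVNodes.N06AtOpsYOfLettersAllPinsC

end
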